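import Literature.MathematicalPhysics.QuantumFieldTheory.Balaban1983to89.B9Thm34HolderAllFinal

/-!
# `Balaban1983to89.B9Thm34HolderInputG` — [Balaban1985BackgroundPropagators] THEOREM 3.4 p. 400 × THEOREM 3.3 p. 399: THE INPUT-HÖLDER MEMBERS
# (3.44)/(3.45) p. 398 (the mixed second differences `∇_UG∇*_U`, bounded with the Hölder norm OF THE INPUT) FOR THE EXTENDED `G(U′U)` OF FILE 28 —
# they transfer from `U` to `U′U` by SUP calculus alone, because the resolvent identity `G(U′U) = G(U) + G(U′U)V(A)G(U)` puts every perturbation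
# letter to the left of the unperturbed data `G(U)∇*λ`, `∇_kG(U)∇*λ` — FILE 37 of the Sect. B programme of cell `lit-balaban`, seat r06 gen 18;
# narrows GAPS G-B9-02 to the `L²` members (3.46)

statement-level skeleton of published theorems with citation tags; proofs where landed; nothing here is a claim about the Yang–Mills mass gap

CITATION HEADER (lean-in-tree rule).  B9 = T. Bałaban, *Propagators for lattice gauge theories in a background field*, Commun. Math. Phys. **99** (1985)
389–434 [Balaban1985BackgroundPropagators] (doi 10.1007/bf01240355; `paper:balaban1985-cmp99-background-propagators`, journal page = PDF page + 388):
Theorem 3.1 (3.42)–(3.45) pp. 397–398 [PDF 9–10] — after (3.43): «Furthermore, there exist constants B′₀(ε), B′₀(ε, β) dependent on d, L and the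
indicated parameters, 0 < ε ≦ 1, 0 ≦ β < 1 (B′₀(ε) → ∞ if ε → 0, B′₀(ε,β) → ∞ if either ε → 0, or β → 1), such that» (3.44) (the sup of
`|(∇_UG′(U)∇*_Uλ)(x)|`, `x ∈ Δ(y)`, `supp λ ⊂ Δ̃(y′)`, bounded by `B′₀(ε)` times an `ε`-Hölder norm of `λ` at the scale `ξ′ = L^{−j′}` plus `|λ|`, times
`e^{−δ₀d(y,y′)}`) and (3.45) (its `β`-Hölder-output twin with `B′₀(ε,β)`); Theorem 3.3 p. 399 [PDF 11] («the operator G(U) (a = 1) satisfies the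
inequalities (3.42)–(3.47), with G′(U) replaced by G(U) and λ replaced by a function J defined at bonds of the lattice»); Theorem 3.4 p. 400 [PDF 12]
(«The extended operators satisfy all the inequalities of Theorems 3.1–3.3 correspondingly»); (3.73) p. 405, (3.76)–(3.77) pp. 405–406, (3.82)–(3.86)
p. 407 [PDF 19] («Δ_a(U′U) = Δ_a(U) − V(A) = (I − V(A)G(U))Δ_a(U)» (3.84); «Theorem (3.3) implies also convergence in all norms appearing in its
formulation, thus in all norms on the left-hand sides of the inequalities (3.42)–(3.47). This way we get all these inequalities for the operator
G(U′U), the local ones follow from the bound (3.85) and Lemma 2.1 [4]»).  [4] = T. Bałaban, *Propagators and renormalization transformations for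
lattice gauge theories. II*, Commun. Math. Phys. **96** (1984) 223–250 [Balaban1984PropagatorsII], (2.51)–(2.55) p. 232 («insert Σ_{y″}Δ(y″) = I»
device of (2.52)), Lemma 2.1 p. 234.  Pages re-read by this seat (r06 gen 18) as text `p0009`–`p0011`, `p0019` of the held paper (the text layer of
(3.44)/(3.45) is degraded; only the SHAPE «B′₀(ε)(Hölder norm of λ + |λ|)e^{−δ₀d}» is used, as ONE abstract number `N` per input).  Cell
`lit-balaban`, seat r06 (B9 fold owner) gen 18, FILE 37; SKELETON rows **B9.Thm3.4** × B9.Thm3.1 ((3.44)/(3.45) cells) × B9.Thm3.3 × B9.Eq3.85 (cells);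
no row head changes.

WHY THIS FILE (B9-CLOSURE §5 item 3 (N)).  After FILES 34–36 the four sup-Hölder members of (3.43) for the extended operators are theorems at the
final level; of Theorem 3.1/3.3's local inequalities for `G(U′U)` there remained the INPUT-Hölder members (3.44)/(3.45) and the `L²` members (3.46)
(GAPS G-B9-02; B9-CLOSURE v2.1 §3 item 1 (ii)).  B9-CLOSURE v2.0 expected (3.44)/(3.45) to need «a sup+Hölder two-weight block calculus on B9 carriers
— none in tree».  They do not: with the resolvent identity in the order `G(U′U) = G(U) + G(U′U)V(A)G(U)` (from `Δ_a(U)G(U) = 1` and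
`G(U′U)(Δ_a(U) − V(A)) = 1`, (3.84)) and the GRADIENT form `V₃ = V⁰ + Σ_kV¹_k∇_k` of the concrete perturbation (gen 11
`B9Eq382V3Letters.conj_V₃Op_eq_gradForm`), `D_lG(U′U)D_sλ = D_lG(U)D_sλ + (D_lG(U′U))·[V⁰(G(U)D_sλ) + Σ_kV¹_k(∇_kG(U)D_sλ) + P₁(G(U)D_sλ) +
P₂(G(U)D_sλ)]`: the Hölder norm of the INPUT enters only through the data of the UNPERTURBED operator — `D_lG(U)D_sλ` and `∇_kG(U)D_sλ`, i.e.
(3.44) FOR `U` — while every other factor is a sup letter of the block-majorant calculus ([4] (2.51)) applied to a function with a decaying block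
PROFILE (§1: «insert Σ_{y″}Δ(y″) = I», (2.52)).  The print's own sentence (p. 407) says the same: the series (3.86) converges in all the norms of
Theorem 3.3, «the local ones follow from the bound (3.85) and Lemma 2.1 [4]».
* §1 `abs_apply_le_sum_of_profile`, `norm_apply_le_sum_of_profile`, `abs_apply_le_of_profile_decay`, `norm_apply_le_of_profile_decay` — an
  operator with a block majorant (resp. a linear functional with a block bound) applied to a function with a (decaying) block profile; the y″-sum
  is `B9Ineq366CPrime.conv_le` ([4] (2.61) + the p. 398 scale transfer).
* §2 `resolvent_right`, `resolvent_right_Ds`, `vTotal_apply_profile` (the profile of `V(A)(G(U)D_sλ)`), **`input344_of_inverse`** (abstract device for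
  (3.44): any carrier), **`input345_of_inverse`** (abstract device for (3.45): any `ℝ`-linear map `Ψ` into a normed space in the rôle of
  `ν ↦ Φ(coord⁻¹(D_lν))`, fed with the (3.43)-left member of the EXTENDED operator).
* §3 **`thm34_all_holderInput_final`** — HYPOTHESES = FILE 34 §5 / FILE 36 VERBATIM (= FILE 28 `B9Thm34AllFinal.thm34_all_final` + `0 < B₀`);
  CONCLUSION `∃ a₁ > 0 ∃ B ≧ 0 ∀ α₁ ≦ a₁ ∀ A …` (FILE 28's premises verbatim) `∃ C⁻¹(U′U), G(U′U)` — the same pair as FILE 28's/FILE 36's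
  ((ii)/(iii) defining identities re-exported) — with (v) the (3.44)-type member and (vi) the (3.45)-type member of THIS `G(U′U)` for every
  left letter `D_l` (`D_lG(U) ≺ B₀Lʲηe^{−δ₀d}`) and right letter `D_s` (`G(U)D_s ≺ B₀Lʲηe^{−δ₀d}`): for every block-supported `λ` and every
  `N ≧ 0` with `|(∇_kG(U)D_sλ)(z)| ≦ Ne^{−δ₀d(y_z,y′)}` (`k ∈ κ ⊕ κ`; in print `N = B′₀(ε)(‖λ‖_ε^{ξ′}(L^{j′}η)^ε + |λ|)`), (v) `|(D_lG(U)D_sλ)(z)| ≦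
  Ne^{−δ₀d}` ⟹ `|(D_lG(U′U)D_sλ)(x)| ≦ B(N + M)e^{−(δ₀/7)d}`; (vi) for `Φ` anchored at `y ∋ p₀` with the (3.43)-left datum for `U` and `N₂ ≧ 0`
  with `‖Φ(D_lG(U)D_sλ)‖ ≦ N₂e^{−δ₀d(y,y′)}` ((3.45) for `U`): `‖Φ(D_lG(U′U)D_sλ)‖ ≦ B(N₂ + B_h(Lʲη)^{1−γ}c_ζ(Lʲη)⁻¹(N + M))e^{−(δ₀/7)d}`.  Inputs
  by name: FILE 28's left-entry operator clause, FILE 36 (iii) (the (3.43)-left member of `G(U′U)`), FILE 25 §3 (3.77) with its `C⁻¹(U′U)`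
  identified with FILE 28's, (3.83) `ineq383_op`, (3.76) `eq376_concrete`, (3.84) `eq384_sub`, the gen-11 `V₃` identifications and majorants;
  FILE 36's pair identified with FILE 28's (`left_inv_eq_right_inv`); clause constants by continuity at `α₁ = 0`.

HONEST SCOPE.  (a) As in FILES 34–36, Theorem 3.1/3.3 FOR `U` enter as INPUTS per input/functional: here the (3.44)/(3.45) data of the UNPERTURBED
operator are ONE non-negative number `N` (resp. `N₂`) attached to the block-supported input `λ` (resp. to `λ` and `Φ`) — the file does NOT
define the `ε`-Hölder norm `‖λ‖_ε^{ξ′}` of (3.44); whatever functional of `λ` the user takes for `N`, the conclusion carries the SAME `N` with a new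
constant («with different constants only»), which is exactly the content of the transfer.  (b) `D_l`, `D_s` are arbitrary letters with the
(3.42)₂/(3.42)₃-type entries for `U`; in print `∇_U`, `∇*_U` («conventional», p. 398).  (c) The (3.44) data are asked for ALL `2d` concrete first
difference letters `∇_k` (the gradient form of `V₃` brings each of them), with the same `N`.  (d) NOT covered anywhere yet: the `L²` members (3.46)
for the extended operators (needs ℓ²-block/Schur majorants — B9-CLOSURE §5 item 3 (O)); the analogous members for `G′(U′U)` (Theorem 3.1 side)
need the concrete `V′(A)` of (3.60) in gradient form acting on the right — not attempted here.  (e) No new definition, no named fact, no row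
head change (B9.Thm3.4 stays `typed-existing`).

Depends on: `B9Thm34HolderAllFinal` (FILE 36), `B9Thm34AllFinal` (FILE 28), `B9Thm34GKernelFinal` (`exists_threshold_pOne`,
`exists_bound_of_continuousAt`), `B9Ineq385VG` (`ineq383_op`, `kappa383`), `B9Ineq385V3Concrete` (`cV385`), `B9Eq382V3Letters`
(`conj_V₃Op_eq_gradForm`, `conj_V₃Op_eq_vThree`, `hasMajorant_V₃_zero`, `hasMajorant_V₃_one`, `V₃Op`, …), `B9Eq372RemLetters`
(`conj_lapDDLetter_prodCfg`), `B9Eq376POneLetters` (`eq376_concrete`), `B9Eq386Neumann` (`eq384_sub`, `vTotal`), `B9Ineq366CPrime` (`conv_le`,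
`scaleTransfer_one`, `hasMajorant_rate_mono`), `B9Ineq385Kernel` (`exp_rate_mono`), `B6RandomWalk` (`blockPiece`, `sum_blockPiece`,
`blockSupp_blockPiece`), Mathlib `left_inv_eq_right_inv` — all used BY NAME.
-/

noncomputable section

namespace Literature.MathematicalPhysics.QuantumFieldTheory.Balaban1983to89.B9Thm34HolderInputG

open NormedSpace Complex
open Literature.MathematicalPhysics.QuantumFieldTheory.Balaban1983to89
open Literature.MathematicalPhysics.QuantumFieldTheory.Balaban1983to89.B6RandomWalk (HasMajorant BlockSupp hasMajorant_mono Triangle254 Ineq261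
  blockPiece sum_blockPiece blockSupp_blockPiece hasMajorant_add)
open Literature.MathematicalPhysics.QuantumFieldTheory.Balaban1983to89.B6RandomWalkHom (HasMajorantHom)
open Literature.MathematicalPhysics.QuantumFieldTheory.Balaban1983to89.B6RandomWalkKernel (HasKernelBound)
open Literature.MathematicalPhysics.QuantumFieldTheory.Balaban1983to89.B6RandomWalkSection (secExt secRes secConj)
open Literature.MathematicalPhysics.QuantumFieldTheory.Balaban1983to89.B9Thm34Ext (toB6)
open Literature.MathematicalPhysics.QuantumFieldTheory.Balaban1983to89.B9Ineq347 (ScaleTransfer)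
open Literature.MathematicalPhysics.QuantumFieldTheory.Balaban1983to89.B9Eq386Neumann (vTotal vThree pTwo deltaA eq384_sub)
open Literature.MathematicalPhysics.QuantumFieldTheory.Balaban1983to89.B9Eq39Adjoint
open Literature.MathematicalPhysics.QuantumFieldTheory.Balaban1983to89.B9Eq369Small (Through)
open Literature.MathematicalPhysics.QuantumFieldTheory.Balaban1983to89.B9Eq372Locality (stBonds)
open Literature.MathematicalPhysics.QuantumFieldTheory.Balaban1983to89.B9Eq352DivForm (tauF tauB)
open Literature.MathematicalPhysics.QuantumFieldTheory.Balaban1983to89.B9Eq352DivFormLetters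
open Literature.MathematicalPhysics.QuantumFieldTheory.Balaban1983to89.B9Eq352GradLetters (diffLetter)
open Literature.MathematicalPhysics.QuantumFieldTheory.Balaban1983to89.B9Eq371GradLetters (bT bU zeroLetter V1Letter)
open Literature.MathematicalPhysics.QuantumFieldTheory.Balaban1983to89.B9Eq375GradLetters (zeroLetter₂ V1Letter₂)
open Literature.MathematicalPhysics.QuantumFieldTheory.Balaban1983to89.B9Eq372RemLetters
open Literature.MathematicalPhysics.QuantumFieldTheory.Balaban1983to89.B9Eq382V3Letters
open Literature.MathematicalPhysics.QuantumFieldTheory.Balaban1983to89.B9Eq376POneLetters (conjHom gradLin divLin eq376_concrete)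
open Literature.MathematicalPhysics.QuantumFieldTheory.Balaban1983to89.B9Eq360Vprime (gPrimeExtEnd)
open Literature.MathematicalPhysics.QuantumFieldTheory.Balaban1983to89.B9Eq360VprimeLetters (vPrimeConc)
open Literature.MathematicalPhysics.QuantumFieldTheory.Balaban1983to89.B9Ineq385VG (kappa383 kappa383_nonneg ineq383_op)
open Literature.MathematicalPhysics.QuantumFieldTheory.Balaban1983to89.B9Ineq385V3Concrete (cV385 cV0_nonneg cV385_nonneg)
open Literature.MathematicalPhysics.QuantumFieldTheory.Balaban1983to89.B9Ineq385Kernel (exp_rate_mono)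
open Literature.MathematicalPhysics.QuantumFieldTheory.Balaban1983to89.B9Ineq366CPrime (conv_le scaleTransfer_one hasMajorant_rate_mono)
open Literature.MathematicalPhysics.QuantumFieldTheory.Balaban1983to89.B9Thm34GKernelFinal (exists_threshold_pOne exists_bound_of_continuousAt)
open Literature.MathematicalPhysics.QuantumFieldTheory.Balaban1983to89.B9Thm34AllFinal (thm34_all_final)
open Literature.MathematicalPhysics.QuantumFieldTheory.Balaban1983to89.B9Thm34HolderAllFinal (thm34_all_holder_final)

/-! ## §1  An operator with a block majorant applied to a function with a block PROFILE ([4] (2.52): insert `Σ_{y″} Δ(y″) = I`) -/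

section Profile

variable {g : B9.Geometry} [Fintype g.Site] {R : ℝ} {H : Prop} {W : Type}

/-- **Majorant × profile** ([4] (2.52) p. 232, «insert Σ_{y″}Δ(y″) = I»): if `T ≺ K` on 𝔅 and a function `f` has the block profile
`|f(z)| ≦ P(y″)` for `z ∈ Δ(y″)` (`P ≧ 0`), then `|(Tf)(x)| ≦ Σ_{y″} K(y, y″)P(y″)` for `x ∈ Δ(y)` — `f = Σ_{y″} Δ(y″)f`, each piece block-supported.
[cite: Balaban1984PropagatorsII, (2.51)–(2.52) p.232 (bookkeeping ours)] -/
theorem abs_apply_le_sum_of_profile (blk : W → g.Site) {T : Module.End ℝ (W → ℝ)} {K : g.Site → g.Site → ℝ}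
    (hT : HasMajorant (g := toB6 g R H) blk T K) {f : W → ℝ} {P : g.Site → ℝ} (hP : ∀ y, 0 ≤ P y)
    (hf : ∀ z, |f z| ≤ P (blk z)) (x : W) :
    |T f x| ≤ ∑ y'' : g.Site, K (blk x) y'' * P y'' := by
  classical
  have hpiece : ∀ y'' : g.Site, |T (blockPiece (g := toB6 g R H) blk y'' f) x| ≤ K (blk x) y'' * P y'' := fun y'' =>
    hT y'' _ _ (blockSupp_blockPiece (g := toB6 g R H) blk f y'' (P y'') (hP y'') (fun z hz => by rw [← hz]; exact hf z)) x
  conv_lhs => rw [← sum_blockPiece (g := toB6 g R H) blk f, map_sum, Finset.sum_apply]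
  exact (Finset.abs_sum_le_sum_abs _ _).trans (Finset.sum_le_sum fun y'' _ => hpiece y'')

/-- **Functional × profile**: the same for an `ℝ`-linear map `Ψ` into a normed space with a block bound `‖Ψν‖ ≦ K(y″)|ν|` for `ν` supported
in `Δ(y″)`: `‖Ψ f‖ ≦ Σ_{y″} K(y″)P(y″)`. [cite: Balaban1984PropagatorsII, (2.51)–(2.52) p.232 (bookkeeping ours)] -/
theorem norm_apply_le_sum_of_profile {E : Type*} [NormedAddCommGroup E] [NormedSpace ℝ E] (blk : W → g.Site)
    (Ψ : (W → ℝ) →ₗ[ℝ] E) {K : g.Site → ℝ}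
    (hΨ : ∀ (y'' : g.Site) (ν : W → ℝ) (C : ℝ), BlockSupp (g := toB6 g R H) blk ν y'' C → ‖Ψ ν‖ ≤ K y'' * C)
    {f : W → ℝ} {P : g.Site → ℝ} (hP : ∀ y, 0 ≤ P y) (hf : ∀ z, |f z| ≤ P (blk z)) :
    ‖Ψ f‖ ≤ ∑ y'' : g.Site, K y'' * P y'' := by
  classical
  have hpiece : ∀ y'' : g.Site, ‖Ψ (blockPiece (g := toB6 g R H) blk y'' f)‖ ≤ K y'' * P y'' := fun y'' =>
    hΨ y'' _ _ (blockSupp_blockPiece (g := toB6 g R H) blk f y'' (P y'') (hP y'') (fun z hz => by rw [← hz]; exact hf z))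
  conv_lhs => rw [← sum_blockPiece (g := toB6 g R H) blk f, map_sum]
  exact (norm_sum_le _ _).trans (Finset.sum_le_sum fun y'' _ => hpiece y'')

/-- **Majorant × DECAYING profile** (the y″-sum by `B9Ineq366CPrime.conv_le`: [4] (2.61) at `β`, the p. 398 scale transfer of `w₂` at `α`
with constant `C`, rates `r ≧ ρ + (α+β)δ₀`): `T ≺ A₁w₁(y)e^{−r d}` and `|f(z)| ≦ N·w₂(y″)e^{−ρ d(y″,y′)}` on `Δ(y″)` give `|(Tf)(x)| ≦
A₁NCc₁(β)·w₁(y)w₂(y)·e^{−ρ d(y,y′)}`, `x ∈ Δ(y)`. [cite: Balaban1984PropagatorsII, (2.52)–(2.55) p.232 + Lemma 2.1 p.234; Balaban1985BackgroundPropagators, p.398 remark (bookkeeping ours)] -/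
theorem abs_apply_le_of_profile_decay (blk : W → g.Site) (d : ℕ) (δ₀ α β ρ r C A₁ N : ℝ) (w₁ w₂ : g.Site → ℝ)
    (hw₁ : ∀ a, 0 ≤ w₁ a) (hw₂ : ∀ a, 0 ≤ w₂ a) (hC : 0 ≤ C) (hA₁ : 0 ≤ A₁) (hN : 0 ≤ N) (hρ : 0 ≤ ρ)
    (hr : ρ + (α + β) * δ₀ ≤ r) (hdnn : ∀ a b : g.Site, 0 ≤ g.dist a b) (htri : Triangle254 (toB6 g R H))
    (hST : ScaleTransfer g δ₀ α C w₂) (h261 : Ineq261 d (toB6 g R H) δ₀ β)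
    {T : Module.End ℝ (W → ℝ)}
    (hT : HasMajorant (g := toB6 g R H) blk T (fun a b => A₁ * w₁ a * Real.exp (-(r * g.dist a b))))
    {f : W → ℝ} (y' : g.Site) (hf : ∀ z, |f z| ≤ N * w₂ (blk z) * Real.exp (-(ρ * g.dist (blk z) y'))) (x : W) :
    |T f x| ≤ A₁ * N * C * B6.c1 d δ₀ β * (w₁ (blk x) * w₂ (blk x)) * Real.exp (-(ρ * g.dist (blk x) y')) := by
  have h1 := abs_apply_le_sum_of_profile (R := R) (H := H) blk hT
    (P := fun c => N * w₂ c * Real.exp (-(ρ * g.dist c y')))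
    (fun c => mul_nonneg (mul_nonneg hN (hw₂ c)) (Real.exp_nonneg _)) hf x
  have hc := conv_le (R := R) (H := H) d δ₀ α β ρ r C w₁ w₂ hw₁ hw₂ hC hρ hr hdnn htri hST h261 (blk x) y'
  calc |T f x| ≤ ∑ c : g.Site, A₁ * w₁ (blk x) * Real.exp (-(r * g.dist (blk x) c)) * (N * w₂ c * Real.exp (-(ρ * g.dist c y'))) := h1
    _ = (A₁ * N) * ∑ c : g.Site, (w₁ (blk x) * Real.exp (-(r * g.dist (blk x) c))) * (w₂ c * Real.exp (-(ρ * g.dist c y'))) := by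
        rw [Finset.mul_sum]
        exact Finset.sum_congr rfl fun c _ => by ring
    _ ≤ (A₁ * N) * (C * B6.c1 d δ₀ β * (w₁ (blk x) * w₂ (blk x)) * Real.exp (-(ρ * g.dist (blk x) y'))) :=
        mul_le_mul_of_nonneg_left hc (mul_nonneg hA₁ hN)
    _ = A₁ * N * C * B6.c1 d δ₀ β * (w₁ (blk x) * w₂ (blk x)) * Real.exp (-(ρ * g.dist (blk x) y')) := by ring

/-- **Functional × DECAYING profile** (anchor `y₀`): `‖Ψν‖ ≦ A₁e^{−r d(y₀,y″)}|ν|` for `ν ⊂ Δ(y″)` and `|f(z)| ≦ N·w₂(y″)e^{−ρ d(y″,y′)}` give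
`‖Ψ f‖ ≦ A₁NCc₁(β)·w₂(y₀)·e^{−ρ d(y₀,y′)}`. [cite: Balaban1984PropagatorsII, (2.52)–(2.55) p.232 + Lemma 2.1 p.234; Balaban1985BackgroundPropagators, p.398 remark (bookkeeping ours)] -/
theorem norm_apply_le_of_profile_decay {E : Type*} [NormedAddCommGroup E] [NormedSpace ℝ E] (blk : W → g.Site) (d : ℕ)
    (δ₀ α β ρ r C A₁ N : ℝ) (w₂ : g.Site → ℝ)
    (hw₂ : ∀ a, 0 ≤ w₂ a) (hC : 0 ≤ C) (hA₁ : 0 ≤ A₁) (hN : 0 ≤ N) (hρ : 0 ≤ ρ)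
    (hr : ρ + (α + β) * δ₀ ≤ r) (hdnn : ∀ a b : g.Site, 0 ≤ g.dist a b) (htri : Triangle254 (toB6 g R H))
    (hST : ScaleTransfer g δ₀ α C w₂) (h261 : Ineq261 d (toB6 g R H) δ₀ β)
    (Ψ : (W → ℝ) →ₗ[ℝ] E) (y₀ : g.Site)
    (hΨ : ∀ (y'' : g.Site) (ν : W → ℝ) (B : ℝ), BlockSupp (g := toB6 g R H) blk ν y'' B →
      ‖Ψ ν‖ ≤ A₁ * Real.exp (-(r * g.dist y₀ y'')) * B)
    {f : W → ℝ} (y' : g.Site) (hf : ∀ z, |f z| ≤ N * w₂ (blk z) * Real.exp (-(ρ * g.dist (blk z) y'))) :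
    ‖Ψ f‖ ≤ A₁ * N * C * B6.c1 d δ₀ β * w₂ y₀ * Real.exp (-(ρ * g.dist y₀ y')) := by
  have h1 := norm_apply_le_sum_of_profile (R := R) (H := H) blk Ψ hΨ
    (P := fun c => N * w₂ c * Real.exp (-(ρ * g.dist c y')))
    (fun c => mul_nonneg (mul_nonneg hN (hw₂ c)) (Real.exp_nonneg _)) hf
  have hc := conv_le (R := R) (H := H) d δ₀ α β ρ r C (fun _ => (1 : ℝ)) w₂ (fun _ => zero_le_one) hw₂ hC hρ hr hdnn htri
    hST h261 y₀ y'
  calc ‖Ψ f‖ ≤ ∑ c : g.Site, A₁ * Real.exp (-(r * g.dist y₀ c)) * (N * w₂ c * Real.exp (-(ρ * g.dist c y'))) := h1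
    _ = (A₁ * N) * ∑ c : g.Site, ((1 : ℝ) * Real.exp (-(r * g.dist y₀ c))) * (w₂ c * Real.exp (-(ρ * g.dist c y'))) := by
        rw [Finset.mul_sum]
        exact Finset.sum_congr rfl fun c _ => by ring
    _ ≤ (A₁ * N) * (C * B6.c1 d δ₀ β * ((1 : ℝ) * w₂ y₀) * Real.exp (-(ρ * g.dist y₀ y'))) :=
        mul_le_mul_of_nonneg_left hc (mul_nonneg hA₁ hN)
    _ = A₁ * N * C * B6.c1 d δ₀ β * w₂ y₀ * Real.exp (-(ρ * g.dist y₀ y')) := by ring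

end Profile

/-! ## §2  The device: the resolvent identity `G(U′U) = G(U) + G(U′U)V(A)G(U)` puts every perturbation letter to the LEFT of the data
`G(U)D_sλ`, `∇_kG(U)D_sλ` of the UNPERTURBED operator — the input-Hölder members of (3.44)/(3.45) transfer with sup calculus only -/

section Device

variable {g : B9.Geometry} [Fintype g.Site] {R : ℝ} {H : Prop} {W : Type} {K : Type}

/-- The resolvent identity in the OTHER order than FILE 35's: from `Δ_a(U)G(U) = 1` and `G(U′U)(Δ_a(U) − V(A)) = 1` ((3.84) with the two-sided
inverse of FILE 28), `G(U′U) = G(U) + G(U′U)V(A)G(U)`. [cite: Balaban1985BackgroundPropagators, (3.84)–(3.86) p.407 (bookkeeping ours)] -/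
theorem resolvent_right {Rg : Type*} [Ring Rg] {Δa V G GExt : Rg} (hΔG : Δa * G = 1) (hE : GExt * (Δa - V) = 1) :
    GExt = G + GExt * V * G := by
  have e1 : GExt * (Δa - V) * G = G := by rw [hE, one_mul]
  have e2 : GExt * (Δa - V) * G = GExt - GExt * V * G := by
    rw [mul_sub, sub_mul, mul_assoc GExt Δa G, hΔG, mul_one]
  rw [e2] at e1
  exact sub_eq_iff_eq_add.mp e1

set_option maxHeartbeats 800000 in
/-- **THE PROFILE OF `V(A)(G(U)D_sλ)`** — every perturbation letter applied to the data of the UNPERTURBED operator.  Letters: `V(A) = V₃ + P₁ + P₂`,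
`V₃ = V⁰ + Σ_{k∈s}V¹_k∇_k` in GRADIENT form with (3.73) sizes `V⁰ ≺ c_Vα₁(Lʲη)⁻²e^{−δd}`, `V¹_k ≺ c_{1,k}α₁(Lʲη)⁻¹e^{−δd}` (`Σc_{1,k} ≦ c_V`), (3.77)
`P₁ ≺ κ₁α₁(Lʲη)⁻²e^{−δd}`, (3.83) `P₂ ≺ κ₂α₁(Lʲη)⁻²e^{−δd}`; the sup letter `G(U)D_s ≺ B₀Lʲηe^{−δd}` ((3.42)₃ for `U`).  INPUT for ONE block-supported `λ`
(`supp λ ⊂ Δ(y′)`, `|λ| ≦ M`) and ONE number `N ≧ 0` (in print `N = B′₀(ε)(‖λ‖_ε^{ξ′}(L^{j′}η)^ε + |λ|)`, (3.44) p. 398): the mixed second differences of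
the unperturbed operator obey `|(∇_kG(U)D_sλ)(z)| ≦ Ne^{−δd(y_z,y′)}` (`k ∈ s`).  THEN `V(A)(G(U)D_sλ) = V⁰(G(U)D_sλ) + Σ_kV¹_k(∇_kG(U)D_sλ) +
P₁(G(U)D_sλ) + P₂(G(U)D_sλ)` has the profile `α₁c₁(δ₀,β)[(c_V + κ₁ + κ₂)B₀ΛM + c_VN]·(Lʲη)⁻¹·e^{−ρd(y_z,y′)}` (`ρ + (α+β)δ₀ ≦ δ`; §1 four times).
[cite: Balaban1985BackgroundPropagators, (3.44) p.398 + (3.73) p.405 + (3.77) p.406 + (3.83)–(3.85) p.407; Balaban1984PropagatorsII, (2.51)–(2.55) p.232 + Lemma 2.1 p.234] -/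
theorem vTotal_apply_profile (blk : W → g.Site) (d : ℕ) (s : Finset K)
    (δ₀ δ α β ρ Λ cV κ₁ κ₂ α₁ B₀ : ℝ) (c1 : K → ℝ)
    (hB₀ : 0 ≤ B₀) (hcV : 0 ≤ cV) (hκ₁ : 0 ≤ κ₁) (hκ₂ : 0 ≤ κ₂) (hα₁ : 0 ≤ α₁) (hΛ : 0 ≤ Λ) (hρ : 0 ≤ ρ)
    (hα : 0 ≤ α) (hβ : 0 ≤ β) (hδ₀ : 0 ≤ δ₀) (hr : ρ + (α + β) * δ₀ ≤ δ)
    (hc1 : ∀ k ∈ s, 0 ≤ c1 k) (hsum : ∑ k ∈ s, c1 k ≤ cV)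
    (hdnn : ∀ a a' : g.Site, 0 ≤ g.dist a a') (htri : Triangle254 (toB6 g R H)) (hlen : ∀ y : g.Site, 0 < g.len y)
    (h261 : Ineq261 d (toB6 g R H) δ₀ β) (hT1 : ScaleTransfer g δ₀ α Λ (fun a => g.len a))
    {G Ds V₃ V0 P₁ P₂ : Module.End ℝ (W → ℝ)} {V1 D : K → Module.End ℝ (W → ℝ)}
    (hV₃ : V₃ = V0 + ∑ k ∈ s, V1 k * D k)
    (hV0 : HasMajorant (g := toB6 g R H) blk V0
      (fun a a' => cV * α₁ * (g.len a ^ 2)⁻¹ * Real.exp (-(δ * g.dist a a'))))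
    (hV1 : ∀ k ∈ s, HasMajorant (g := toB6 g R H) blk (V1 k)
      (fun a a' => c1 k * α₁ * (g.len a)⁻¹ * Real.exp (-(δ * g.dist a a'))))
    (hP₁ : HasMajorant (g := toB6 g R H) blk P₁ (fun a a' => κ₁ * α₁ * (g.len a ^ 2)⁻¹ * Real.exp (-(δ * g.dist a a'))))
    (hP₂ : HasMajorant (g := toB6 g R H) blk P₂ (fun a a' => κ₂ * α₁ * (g.len a ^ 2)⁻¹ * Real.exp (-(δ * g.dist a a'))))
    (hGDs : HasMajorant (g := toB6 g R H) blk (G * Ds) (fun a a' => B₀ * g.len a * Real.exp (-(δ * g.dist a a'))))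
    (y' : g.Site) (μ : W → ℝ) (M : ℝ) (hμ : BlockSupp (g := toB6 g R H) blk μ y' M) (N : ℝ) (hN : 0 ≤ N)
    (h344 : ∀ k ∈ s, ∀ z : W, |((D k * G * Ds) μ) z| ≤ N * Real.exp (-(δ * g.dist (blk z) y')))
    (z : W) :
    |(vTotal V₃ P₁ P₂) ((G * Ds) μ) z| ≤
      (α₁ * B6.c1 d δ₀ β * ((cV + κ₁ + κ₂) * B₀ * Λ * M + cV * N)) * (g.len (blk z))⁻¹ * Real.exp (-(ρ * g.dist (blk z) y')) := by
  have hM : 0 ≤ M := hμ.nonneg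
  have hE₀ : ∀ (t : ℝ) (a a' : g.Site), 0 ≤ Real.exp (-(t * g.dist a a')) := fun t a a' => Real.exp_nonneg _
  have hρδ : ρ ≤ δ := by
    have : 0 ≤ (α + β) * δ₀ := mul_nonneg (add_nonneg hα hβ) hδ₀
    linarith
  have hc₁ : 0 ≤ B6.c1 d δ₀ β := B6RandomWalk.c1_nonneg d δ₀ β
  -- the data of the unperturbed operator: `g₀ = G(U)D_sλ` with its profile, the mixed differences `f_k = ∇_kG(U)D_sλ`
  set g₀ : W → ℝ := (G * Ds) μ with hg₀
  have hg₀p : ∀ z, |g₀ z| ≤ B₀ * M * g.len (blk z) * Real.exp (-(ρ * g.dist (blk z) y')) := fun z => by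
    have h1 := hGDs y' μ M hμ z
    have h2 : B₀ * g.len (blk z) * Real.exp (-(δ * g.dist (blk z) y')) * M ≤
        B₀ * g.len (blk z) * Real.exp (-(ρ * g.dist (blk z) y')) * M :=
      mul_le_mul_of_nonneg_right (mul_le_mul_of_nonneg_left (exp_rate_mono hρδ (hdnn _ _))
        (mul_nonneg hB₀ (hlen _).le)) hM
    calc |g₀ z| ≤ B₀ * g.len (blk z) * Real.exp (-(δ * g.dist (blk z) y')) * M := h1
      _ ≤ _ := h2
      _ = B₀ * M * g.len (blk z) * Real.exp (-(ρ * g.dist (blk z) y')) := by ring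
  have hfkp : ∀ k ∈ s, ∀ z, |((D k * G * Ds) μ) z| ≤ N * (fun _ : g.Site => (1 : ℝ)) (blk z) * Real.exp (-(ρ * g.dist (blk z) y')) :=
    fun k hk z => (h344 k hk z).trans (by
      rw [mul_one]
      exact mul_le_mul_of_nonneg_left (exp_rate_mono hρδ (hdnn _ _)) hN)
  -- the four bracket terms, each an operator with a majorant applied to a profile (§1), output weight `(Lʲη)⁻¹`, rate `ρ`
  have hw2i : ∀ a : g.Site, 0 ≤ (g.len a ^ 2)⁻¹ := fun a => inv_nonneg.mpr (sq_nonneg _)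
  have hw1i : ∀ a : g.Site, 0 ≤ (g.len a)⁻¹ := fun a => inv_nonneg.mpr (hlen a).le
  have hwl : ∀ a : g.Site, 0 ≤ g.len a := fun a => (hlen a).le
  have hV0g : ∀ z, |V0 g₀ z| ≤ cV * α₁ * (B₀ * M) * Λ * B6.c1 d δ₀ β * ((g.len (blk z) ^ 2)⁻¹ * g.len (blk z)) *
      Real.exp (-(ρ * g.dist (blk z) y')) := fun z =>
    abs_apply_le_of_profile_decay (R := R) (H := H) blk d δ₀ α β ρ δ Λ (cV * α₁) (B₀ * M) (fun a => (g.len a ^ 2)⁻¹)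
      (fun a => g.len a) hw2i hwl hΛ (mul_nonneg hcV hα₁) (mul_nonneg hB₀ hM) hρ hr hdnn htri hT1 h261 hV0 y' hg₀p z
  have hP₁g : ∀ z, |P₁ g₀ z| ≤ κ₁ * α₁ * (B₀ * M) * Λ * B6.c1 d δ₀ β * ((g.len (blk z) ^ 2)⁻¹ * g.len (blk z)) *
      Real.exp (-(ρ * g.dist (blk z) y')) := fun z =>
    abs_apply_le_of_profile_decay (R := R) (H := H) blk d δ₀ α β ρ δ Λ (κ₁ * α₁) (B₀ * M) (fun a => (g.len a ^ 2)⁻¹)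
      (fun a => g.len a) hw2i hwl hΛ (mul_nonneg hκ₁ hα₁) (mul_nonneg hB₀ hM) hρ hr hdnn htri hT1 h261 hP₁ y' hg₀p z
  have hP₂g : ∀ z, |P₂ g₀ z| ≤ κ₂ * α₁ * (B₀ * M) * Λ * B6.c1 d δ₀ β * ((g.len (blk z) ^ 2)⁻¹ * g.len (blk z)) *
      Real.exp (-(ρ * g.dist (blk z) y')) := fun z =>
    abs_apply_le_of_profile_decay (R := R) (H := H) blk d δ₀ α β ρ δ Λ (κ₂ * α₁) (B₀ * M) (fun a => (g.len a ^ 2)⁻¹)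
      (fun a => g.len a) hw2i hwl hΛ (mul_nonneg hκ₂ hα₁) (mul_nonneg hB₀ hM) hρ hr hdnn htri hT1 h261 hP₂ y' hg₀p z
  have hαδ : 0 ≤ α * δ₀ := mul_nonneg hα hδ₀
  have hV1g : ∀ k ∈ s, ∀ z, |V1 k ((D k * G * Ds) μ) z| ≤ c1 k * α₁ * N * 1 * B6.c1 d δ₀ β * ((g.len (blk z))⁻¹ * 1) *
      Real.exp (-(ρ * g.dist (blk z) y')) := fun k hk z =>
    abs_apply_le_of_profile_decay (R := R) (H := H) blk d δ₀ α β ρ δ 1 (c1 k * α₁) N (fun a => (g.len a)⁻¹)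
      (fun _ => (1 : ℝ)) hw1i (fun _ => zero_le_one) zero_le_one (mul_nonneg (hc1 k hk) hα₁) hN hρ hr hdnn htri
      (scaleTransfer_one hαδ hdnn) h261 (hV1 k hk) y' (hfkp k hk) z
  -- the bracket `V(A)(G(U)D_sλ)` as a function and its profile
  have hfV_eq : (vTotal V₃ P₁ P₂) g₀ z = V0 g₀ z + (∑ k ∈ s, V1 k ((D k * G * Ds) μ) z) + P₁ g₀ z + P₂ g₀ z := by
    have e1 : (vTotal V₃ P₁ P₂) g₀ = V0 g₀ + (∑ k ∈ s, V1 k ((D k * G * Ds) μ)) + P₁ g₀ + P₂ g₀ := by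
      rw [vTotal, hV₃]
      simp only [LinearMap.add_apply, LinearMap.sum_apply, Module.End.mul_apply, hg₀]
    rw [e1]
    simp only [Pi.add_apply, Finset.sum_apply]
  have hlenz : (g.len (blk z) ^ 2)⁻¹ * g.len (blk z) = (g.len (blk z))⁻¹ := by
    have := (hlen (blk z)).ne'
    field_simp
  rw [hfV_eq]
  have hs : |∑ k ∈ s, V1 k ((D k * G * Ds) μ) z| ≤ ∑ k ∈ s, c1 k * α₁ * N * 1 * B6.c1 d δ₀ β * ((g.len (blk z))⁻¹ * 1) *
      Real.exp (-(ρ * g.dist (blk z) y')) :=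
    (Finset.abs_sum_le_sum_abs _ _).trans (Finset.sum_le_sum fun k hk => hV1g k hk z)
  have hs' : ∑ k ∈ s, c1 k * α₁ * N * 1 * B6.c1 d δ₀ β * ((g.len (blk z))⁻¹ * 1) * Real.exp (-(ρ * g.dist (blk z) y'))
      ≤ cV * α₁ * N * B6.c1 d δ₀ β * (g.len (blk z))⁻¹ * Real.exp (-(ρ * g.dist (blk z) y')) := by
    rw [← Finset.sum_mul, ← Finset.sum_mul, ← Finset.sum_mul, ← Finset.sum_mul, ← Finset.sum_mul, ← Finset.sum_mul]
    have : (∑ k ∈ s, c1 k) * α₁ * N * 1 * B6.c1 d δ₀ β * ((g.len (blk z))⁻¹ * 1) * Real.exp (-(ρ * g.dist (blk z) y'))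
        ≤ cV * α₁ * N * 1 * B6.c1 d δ₀ β * ((g.len (blk z))⁻¹ * 1) * Real.exp (-(ρ * g.dist (blk z) y')) :=
      mul_le_mul_of_nonneg_right (mul_le_mul_of_nonneg_right (mul_le_mul_of_nonneg_right (mul_le_mul_of_nonneg_right
        (mul_le_mul_of_nonneg_right (mul_le_mul_of_nonneg_right hsum hα₁) hN) zero_le_one) hc₁)
        (mul_nonneg (hw1i _) zero_le_one)) (hE₀ ρ _ _)
    refine this.trans (le_of_eq ?_)
    ring
  have h4 := (abs_add_le _ _).trans (add_le_add ((abs_add_le _ _).trans (add_le_add ((abs_add_le _ _).trans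
    (add_le_add (hV0g z) (hs.trans hs'))) (hP₁g z))) (hP₂g z))
  refine h4.trans (le_of_eq ?_)
  rw [hlenz]
  ring

/-- The resolvent identity put to work on a right letter: `G(U′U)D_s = G(U)D_s + G(U′U)·V(A)·(G(U)D_s)`.
[cite: Balaban1985BackgroundPropagators, (3.84)–(3.86) p.407 (bookkeeping ours)] -/
theorem resolvent_right_Ds {Rg : Type*} [Ring Rg] {Δa V G GExt : Rg} (hΔG : Δa * G = 1) (hE : GExt * (Δa - V) = 1) (Dl Ds : Rg) :
    Dl * GExt * Ds = Dl * G * Ds + (Dl * GExt) * (V * (G * Ds)) := by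
  conv_lhs => rw [resolvent_right hΔG hE]
  noncomm_ring

set_option maxHeartbeats 800000 in
/-- **(3.44)-TYPE MEMBER (INPUT HÖLDER NORM, SUP OUTPUT) SURVIVES THE PERTURBATION — abstract device.**  Letters and input as in
`vTotal_apply_profile`, plus `Δ_a(U)G(U) = 1`, `G(U′U)(Δ_a(U) − V(A)) = 1` ((3.84) with the two-sided inverse of FILE 28), a left letter `D_l` with the sup
entry `D_lG(U′U) ≺ A₂Lʲηe^{−ρ₂d}` of the EXTENDED operator ((3.42)₂ for `U′U`) and the (3.44) datum `|(D_lG(U)D_sλ)(z)| ≦ Ne^{−δd}` for `D_l` itself.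
THEN `|(D_lG(U′U)D_sλ)(x)| ≦ [N(1 + α₁A₂Cc₁(r₀,β′)c_Vc₁(δ₀,β)) + M·α₁A₂Cc₁(r₀,β′)B₀Λc₁(δ₀,β)(c_V + κ₁ + κ₂)]·e^{−ρ₃d(y_x,y′)}` for `ρ₃ + (α′+β′)r₀ ≦ ρ₂`,
`0 ≦ ρ₃ ≦ ρ` (outer composition: scale transfer of `(Lʲη)⁻¹` at `(r₀, α′, C)`, [4] (2.61) at `(r₀, β′)`) — the printed SHAPE `B″(ε)(‖λ‖_ε^{ξ′}(L^{j′}η)^ε +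
|λ|)e^{−δd}` of (3.44) «with different constants only».  PROOF: `D_lG(U′U)D_sλ = D_lG(U)D_sλ + (D_lG(U′U))·V(A)(G(U)D_sλ)` (`resolvent_right_Ds`), the
profile of `vTotal_apply_profile`, §1 once more.
[cite: Balaban1985BackgroundPropagators, Thm 3.4 p.400 + (3.44) p.398 + Thm 3.3 p.399 + (3.73) p.405 + (3.77) p.406 + (3.83)–(3.86) p.407; Balaban1984PropagatorsII, (2.51)–(2.55) p.232 + Lemma 2.1 p.234] -/
theorem input344_of_inverse (blk : W → g.Site) (d : ℕ) (s : Finset K)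
    (δ₀ δ α β ρ Λ cV κ₁ κ₂ α₁ B₀ r₀ α' β' C ρ₂ ρ₃ A₂ : ℝ) (c1 : K → ℝ)
    (hB₀ : 0 ≤ B₀) (hcV : 0 ≤ cV) (hκ₁ : 0 ≤ κ₁) (hκ₂ : 0 ≤ κ₂) (hα₁ : 0 ≤ α₁) (hΛ : 0 ≤ Λ) (hρ : 0 ≤ ρ)
    (hα : 0 ≤ α) (hβ : 0 ≤ β) (hδ₀ : 0 ≤ δ₀) (hr : ρ + (α + β) * δ₀ ≤ δ)
    (hc1 : ∀ k ∈ s, 0 ≤ c1 k) (hsum : ∑ k ∈ s, c1 k ≤ cV)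
    (hC : 0 ≤ C) (hA₂ : 0 ≤ A₂) (hρ₃ : 0 ≤ ρ₃) (hρ₃r : ρ₃ + (α' + β') * r₀ ≤ ρ₂) (hρ₃ρ : ρ₃ ≤ ρ)
    (hdnn : ∀ a a' : g.Site, 0 ≤ g.dist a a') (htri : Triangle254 (toB6 g R H)) (hlen : ∀ y : g.Site, 0 < g.len y)
    (h261 : Ineq261 d (toB6 g R H) δ₀ β) (h261c : Ineq261 d (toB6 g R H) r₀ β')
    (hT1 : ScaleTransfer g δ₀ α Λ (fun a => g.len a)) (hTci : ScaleTransfer g r₀ α' C (fun a => (g.len a)⁻¹))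
    {G GExt Ds Dl Δa V₃ V0 P₁ P₂ : Module.End ℝ (W → ℝ)} {V1 D : K → Module.End ℝ (W → ℝ)}
    (hV₃ : V₃ = V0 + ∑ k ∈ s, V1 k * D k)
    (hΔG : Δa * G = 1) (hE : GExt * (Δa - vTotal V₃ P₁ P₂) = 1)
    (hV0 : HasMajorant (g := toB6 g R H) blk V0
      (fun a a' => cV * α₁ * (g.len a ^ 2)⁻¹ * Real.exp (-(δ * g.dist a a'))))
    (hV1 : ∀ k ∈ s, HasMajorant (g := toB6 g R H) blk (V1 k)
      (fun a a' => c1 k * α₁ * (g.len a)⁻¹ * Real.exp (-(δ * g.dist a a'))))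
    (hP₁ : HasMajorant (g := toB6 g R H) blk P₁ (fun a a' => κ₁ * α₁ * (g.len a ^ 2)⁻¹ * Real.exp (-(δ * g.dist a a'))))
    (hP₂ : HasMajorant (g := toB6 g R H) blk P₂ (fun a a' => κ₂ * α₁ * (g.len a ^ 2)⁻¹ * Real.exp (-(δ * g.dist a a'))))
    (hGDs : HasMajorant (g := toB6 g R H) blk (G * Ds) (fun a a' => B₀ * g.len a * Real.exp (-(δ * g.dist a a'))))
    (hDlE : HasMajorant (g := toB6 g R H) blk (Dl * GExt) (fun a a' => A₂ * g.len a * Real.exp (-(ρ₂ * g.dist a a'))))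
    (y' : g.Site) (μ : W → ℝ) (M : ℝ) (hμ : BlockSupp (g := toB6 g R H) blk μ y' M) (N : ℝ) (hN : 0 ≤ N)
    (h344 : ∀ k ∈ s, ∀ z : W, |((D k * G * Ds) μ) z| ≤ N * Real.exp (-(δ * g.dist (blk z) y')))
    (h344l : ∀ z : W, |((Dl * G * Ds) μ) z| ≤ N * Real.exp (-(δ * g.dist (blk z) y')))
    (x : W) :
    |((Dl * GExt * Ds) μ) x| ≤
      (N * (1 + α₁ * A₂ * C * B6.c1 d r₀ β' * cV * B6.c1 d δ₀ β)
        + M * (α₁ * A₂ * C * B6.c1 d r₀ β' * B₀ * Λ * B6.c1 d δ₀ β * (cV + κ₁ + κ₂))) *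
        Real.exp (-(ρ₃ * g.dist (blk x) y')) := by
  have hM : 0 ≤ M := hμ.nonneg
  have hρδ : ρ ≤ δ := by
    have : 0 ≤ (α + β) * δ₀ := mul_nonneg (add_nonneg hα hβ) hδ₀
    linarith
  have hc₁ : 0 ≤ B6.c1 d δ₀ β := B6RandomWalk.c1_nonneg d δ₀ β
  have hw1i : ∀ a : g.Site, 0 ≤ (g.len a)⁻¹ := fun a => inv_nonneg.mpr (hlen a).le
  have hwl : ∀ a : g.Site, 0 ≤ g.len a := fun a => (hlen a).le
  -- the profile of `V(A)(G(U)D_sλ)`, weakened to the rate `ρ₃`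
  have hQ : 0 ≤ α₁ * B6.c1 d δ₀ β * ((cV + κ₁ + κ₂) * B₀ * Λ * M + cV * N) :=
    mul_nonneg (mul_nonneg hα₁ hc₁) (add_nonneg (by positivity) (mul_nonneg hcV hN))
  have hfVp' : ∀ z, |(vTotal V₃ P₁ P₂) ((G * Ds) μ) z| ≤ (α₁ * B6.c1 d δ₀ β * ((cV + κ₁ + κ₂) * B₀ * Λ * M + cV * N)) *
      (g.len (blk z))⁻¹ * Real.exp (-(ρ₃ * g.dist (blk z) y')) := fun z =>
    (vTotal_apply_profile (R := R) (H := H) blk d s δ₀ δ α β ρ Λ cV κ₁ κ₂ α₁ B₀ c1 hB₀ hcV hκ₁ hκ₂ hα₁ hΛ hρ hα hβ hδ₀ hr hc1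
      hsum hdnn htri hlen h261 hT1 hV₃ hV0 hV1 hP₁ hP₂ hGDs y' μ M hμ N hN h344 z).trans
      (mul_le_mul_of_nonneg_left (exp_rate_mono hρ₃ρ (hdnn _ _)) (mul_nonneg hQ (hw1i _)))
  -- the outer application `(D_lG(U′U))·[V(A)(G(U)D_sλ)]`
  have hout := abs_apply_le_of_profile_decay (R := R) (H := H) blk d r₀ α' β' ρ₃ ρ₂ C A₂
    (α₁ * B6.c1 d δ₀ β * ((cV + κ₁ + κ₂) * B₀ * Λ * M + cV * N)) (fun a => g.len a) (fun a => (g.len a)⁻¹) hwl hw1i hC hA₂ hQ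
    hρ₃ hρ₃r hdnn htri hTci h261c hDlE y' hfVp' x
  have hlenx : g.len (blk x) * (g.len (blk x))⁻¹ = 1 := mul_inv_cancel₀ (hlen (blk x)).ne'
  rw [hlenx, mul_one] at hout
  -- the resolvent identity and the split
  have hsplit : ((Dl * GExt * Ds) μ) x = ((Dl * G * Ds) μ) x + (Dl * GExt) ((vTotal V₃ P₁ P₂) ((G * Ds) μ)) x := by
    rw [resolvent_right_Ds hΔG hE Dl Ds]
    simp only [LinearMap.add_apply, Module.End.mul_apply, Pi.add_apply]
  have hfirst : |((Dl * G * Ds) μ) x| ≤ N * Real.exp (-(ρ₃ * g.dist (blk x) y')) :=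
    (h344l x).trans (mul_le_mul_of_nonneg_left (exp_rate_mono (hρ₃ρ.trans hρδ) (hdnn _ _)) hN)
  rw [hsplit]
  refine (abs_add_le _ _).trans ((add_le_add hfirst hout).trans (le_of_eq ?_))
  ring

set_option maxHeartbeats 800000 in
/-- **(3.45)-TYPE MEMBER (INPUT HÖLDER NORM, HÖLDER OUTPUT) SURVIVES THE PERTURBATION — abstract device.**  Letters and input as in
`vTotal_apply_profile`, `Δ_a(U)G(U) = 1`, `G(U′U)(Δ_a(U) − V(A)) = 1`; an `ℝ`-linear map `Ψ` into a normed space (in use: `ν ↦ Φ(coord⁻¹(D_lν))`, `Φ` a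
transported Hölder quotient (3.40) of the bond function anchored at `y₀ ∋ p₀`, `D_l` a left letter) with the (3.43)-LEFT member of the EXTENDED operator
as a block bound `‖Ψ(G(U′U)ν)‖ ≦ A₃e^{−ρ₂d(y₀,y″)}|ν|` (`supp ν ⊂ Δ(y″)`; FILE 36 (iii)) and the (3.45) datum for `U`: `‖Ψ(G(U)D_sλ)‖ ≦ N₂e^{−δd(y₀,y′)}` (in print
`N₂ = B′₀(ε,β)(Lʲη)^{−β}(‖ζ‖_β^ξ + |ζ|)(‖λ‖… + |λ|)`, (3.45) p. 398).  THEN `‖Ψ(G(U′U)D_sλ)‖ ≦ [N₂ + A₃Cc₁(r₀,β′)(L^{j₀}η)⁻¹·α₁c₁(δ₀,β)((c_V + κ₁ +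
κ₂)B₀ΛM + c_VN)]·e^{−ρ₃d(y₀,y′)}`.  PROOF: `G(U′U)D_sλ = G(U)D_sλ + G(U′U)·V(A)(G(U)D_sλ)`, `Ψ` linear, the profile of `vTotal_apply_profile`, §1
(functional × profile). [cite: Balaban1985BackgroundPropagators, Thm 3.4 p.400 + (3.43)/(3.45) p.398 + Thm 3.3 p.399 + (3.73) p.405 + (3.77) p.406 + (3.83)–(3.86) p.407; Balaban1984PropagatorsII, (2.51)–(2.55) p.232 + Lemma 2.1 p.234] -/
theorem input345_of_inverse {E : Type*} [NormedAddCommGroup E] [NormedSpace ℝ E] (blk : W → g.Site) (d : ℕ) (s : Finset K)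
    (δ₀ δ α β ρ Λ cV κ₁ κ₂ α₁ B₀ r₀ α' β' C ρ₂ ρ₃ A₃ : ℝ) (c1 : K → ℝ)
    (hB₀ : 0 ≤ B₀) (hcV : 0 ≤ cV) (hκ₁ : 0 ≤ κ₁) (hκ₂ : 0 ≤ κ₂) (hα₁ : 0 ≤ α₁) (hΛ : 0 ≤ Λ) (hρ : 0 ≤ ρ)
    (hα : 0 ≤ α) (hβ : 0 ≤ β) (hδ₀ : 0 ≤ δ₀) (hr : ρ + (α + β) * δ₀ ≤ δ)
    (hc1 : ∀ k ∈ s, 0 ≤ c1 k) (hsum : ∑ k ∈ s, c1 k ≤ cV)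
    (hC : 0 ≤ C) (hA₃ : 0 ≤ A₃) (hρ₃ : 0 ≤ ρ₃) (hρ₃r : ρ₃ + (α' + β') * r₀ ≤ ρ₂) (hρ₃ρ : ρ₃ ≤ ρ)
    (hdnn : ∀ a a' : g.Site, 0 ≤ g.dist a a') (htri : Triangle254 (toB6 g R H)) (hlen : ∀ y : g.Site, 0 < g.len y)
    (h261 : Ineq261 d (toB6 g R H) δ₀ β) (h261c : Ineq261 d (toB6 g R H) r₀ β')
    (hT1 : ScaleTransfer g δ₀ α Λ (fun a => g.len a)) (hTci : ScaleTransfer g r₀ α' C (fun a => (g.len a)⁻¹))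
    {G GExt Ds Δa V₃ V0 P₁ P₂ : Module.End ℝ (W → ℝ)} {V1 D : K → Module.End ℝ (W → ℝ)}
    (hV₃ : V₃ = V0 + ∑ k ∈ s, V1 k * D k)
    (hΔG : Δa * G = 1) (hE : GExt * (Δa - vTotal V₃ P₁ P₂) = 1)
    (hV0 : HasMajorant (g := toB6 g R H) blk V0
      (fun a a' => cV * α₁ * (g.len a ^ 2)⁻¹ * Real.exp (-(δ * g.dist a a'))))
    (hV1 : ∀ k ∈ s, HasMajorant (g := toB6 g R H) blk (V1 k)
      (fun a a' => c1 k * α₁ * (g.len a)⁻¹ * Real.exp (-(δ * g.dist a a'))))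
    (hP₁ : HasMajorant (g := toB6 g R H) blk P₁ (fun a a' => κ₁ * α₁ * (g.len a ^ 2)⁻¹ * Real.exp (-(δ * g.dist a a'))))
    (hP₂ : HasMajorant (g := toB6 g R H) blk P₂ (fun a a' => κ₂ * α₁ * (g.len a ^ 2)⁻¹ * Real.exp (-(δ * g.dist a a'))))
    (hGDs : HasMajorant (g := toB6 g R H) blk (G * Ds) (fun a a' => B₀ * g.len a * Real.exp (-(δ * g.dist a a'))))
    (Ψ : (W → ℝ) →ₗ[ℝ] E) (y₀ : g.Site)
    (hΨE : ∀ (y'' : g.Site) (ν : W → ℝ) (B : ℝ), BlockSupp (g := toB6 g R H) blk ν y'' B →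
      ‖Ψ (GExt ν)‖ ≤ A₃ * Real.exp (-(ρ₂ * g.dist y₀ y'')) * B)
    (y' : g.Site) (μ : W → ℝ) (M : ℝ) (hμ : BlockSupp (g := toB6 g R H) blk μ y' M) (N : ℝ) (hN : 0 ≤ N)
    (h344 : ∀ k ∈ s, ∀ z : W, |((D k * G * Ds) μ) z| ≤ N * Real.exp (-(δ * g.dist (blk z) y')))
    (N₂ : ℝ) (hN₂ : 0 ≤ N₂) (h345 : ‖Ψ ((G * Ds) μ)‖ ≤ N₂ * Real.exp (-(δ * g.dist y₀ y'))) :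
    ‖Ψ ((GExt * Ds) μ)‖ ≤
      (N₂ + A₃ * C * B6.c1 d r₀ β' * (g.len y₀)⁻¹ * (α₁ * B6.c1 d δ₀ β * ((cV + κ₁ + κ₂) * B₀ * Λ * M + cV * N))) *
        Real.exp (-(ρ₃ * g.dist y₀ y')) := by
  have hM : 0 ≤ M := hμ.nonneg
  have hρδ : ρ ≤ δ := by
    have : 0 ≤ (α + β) * δ₀ := mul_nonneg (add_nonneg hα hβ) hδ₀
    linarith
  have hc₁ : 0 ≤ B6.c1 d δ₀ β := B6RandomWalk.c1_nonneg d δ₀ β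
  have hw1i : ∀ a : g.Site, 0 ≤ (g.len a)⁻¹ := fun a => inv_nonneg.mpr (hlen a).le
  have hQ : 0 ≤ α₁ * B6.c1 d δ₀ β * ((cV + κ₁ + κ₂) * B₀ * Λ * M + cV * N) :=
    mul_nonneg (mul_nonneg hα₁ hc₁) (add_nonneg (by positivity) (mul_nonneg hcV hN))
  have hfVp' : ∀ z, |(vTotal V₃ P₁ P₂) ((G * Ds) μ) z| ≤ (α₁ * B6.c1 d δ₀ β * ((cV + κ₁ + κ₂) * B₀ * Λ * M + cV * N)) *
      (g.len (blk z))⁻¹ * Real.exp (-(ρ₃ * g.dist (blk z) y')) := fun z =>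
    (vTotal_apply_profile (R := R) (H := H) blk d s δ₀ δ α β ρ Λ cV κ₁ κ₂ α₁ B₀ c1 hB₀ hcV hκ₁ hκ₂ hα₁ hΛ hρ hα hβ hδ₀ hr hc1
      hsum hdnn htri hlen h261 hT1 hV₃ hV0 hV1 hP₁ hP₂ hGDs y' μ M hμ N hN h344 z).trans
      (mul_le_mul_of_nonneg_left (exp_rate_mono hρ₃ρ (hdnn _ _)) (mul_nonneg hQ (hw1i _)))
  -- the functional `ν ↦ Ψ(G(U′U)ν)` applied to the profile (§1)
  have hout := norm_apply_le_of_profile_decay (R := R) (H := H) blk d r₀ α' β' ρ₃ ρ₂ C A₃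
    (α₁ * B6.c1 d δ₀ β * ((cV + κ₁ + κ₂) * B₀ * Λ * M + cV * N)) (fun a => (g.len a)⁻¹) hw1i hC hA₃ hQ hρ₃ hρ₃r hdnn htri hTci
    h261c (Ψ ∘ₗ GExt) y₀ (fun c ν B hν => by simpa only [LinearMap.coe_comp, Function.comp_apply] using hΨE c ν B hν) y' hfVp'
  -- the resolvent identity and the split
  have hsplit : Ψ ((GExt * Ds) μ) = Ψ ((G * Ds) μ) + (Ψ ∘ₗ GExt) ((vTotal V₃ P₁ P₂) ((G * Ds) μ)) := by
    have e1 : GExt * Ds = G * Ds + GExt * (vTotal V₃ P₁ P₂ * (G * Ds)) := by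
      simpa only [one_mul] using resolvent_right_Ds hΔG hE (1 : Module.End ℝ (W → ℝ)) Ds
    rw [e1]
    simp only [LinearMap.add_apply, Module.End.mul_apply, map_add, LinearMap.coe_comp, Function.comp_apply]
  have hfirst : ‖Ψ ((G * Ds) μ)‖ ≤ N₂ * Real.exp (-(ρ₃ * g.dist y₀ y')) :=
    h345.trans (mul_le_mul_of_nonneg_left (exp_rate_mono (hρ₃ρ.trans hρδ) (hdnn _ _)) hN₂)
  rw [hsplit]
  refine (norm_add_le _ _).trans ((add_le_add hfirst hout).trans (le_of_eq ?_))
  ring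

end Device


/-! ## §3  THEOREM 3.4 × THEOREM 3.3: THE INPUT-HÖLDER MEMBERS (3.44)/(3.45) FOR THE `G(U′U)` OF FILE 28, PRINTED QUANTIFIERS -/

section Final

variable {𝔸 : Type*} [NormedRing 𝔸] [NormedAlgebra ℂ 𝔸] [CompleteSpace 𝔸] {ι : Type} [Fintype ι]
variable (b : Module.Basis ι ℝ 𝔸) {S : Type} {κ : Type} [Fintype κ] [LinearOrder κ]
variable (T : κ → Equiv.Perm S) (U : κ → S → 𝔸ˣ)
variable {g : B9.Geometry} [Fintype g.Site] {Rr : ℝ} {H : Prop}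

set_option maxHeartbeats 1600000 in
/-- **THEOREM 3.4 × THEOREM 3.3: THE MEMBERS (3.44) AND (3.45) (MIXED SECOND DIFFERENCES, INPUT HÖLDER NORM) FOR THE `G(U′U)` OF FILE 28**
(«|(∇_UG′(U)∇*_Uλ)(x)| ≦ B′₀(ε)(…)e^{−δ₀d(y,y′)} for 0 < ε ≦ 1, x ∈ Δ(y), supp λ ⊂ Δ̃(y′)» (3.44) and its Hölder-output twin (3.45), p. 398 — the right-hand
sides carrying the INPUT Hölder norm `‖λ‖_ε^{ξ′}(L^{j′}η)^ε + |λ|`; Theorem 3.3 p. 399 «with G′(U) replaced by G(U) and λ replaced by a function J defined at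
bonds of the lattice»; for `U′U` by Theorem 3.4 p. 400: «The extended operators satisfy all the inequalities of Theorems 3.1–3.3 correspondingly»).
HYPOTHESES = FILE 34 §5 `thm34_all_holderLeft_final` VERBATIM (= FILE 28's + `0 < B₀`).  CONCLUSION `∃ a₁ > 0 ∃ B ≧ 0 ∀ α₁ ≦ a₁ ∀ A …` (FILE 28's premises
verbatim) `∃ C⁻¹(U′U), G(U′U)` — THE SAME PAIR AS FILE 28's / FILE 36's ((ii)/(iii) defining identities re-exported; uniqueness of two-sided inverses) — with,
for every left letter `D_l` (`D_lG(U) ≺ B₀Lʲηe^{−δ₀d}`) and right letter `D_s` (`G(U)D_s ≺ B₀Lʲηe^{−δ₀d}`), every block-supported input `λ` (`supp λ ⊂ Δ(y′)`,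
`|λ| ≦ M`) and every number `N ≧ 0` such that THE UNPERTURBED mixed differences obey `|(∇_kG(U)D_sλ)(z)| ≦ Ne^{−δ₀d(y_z,y′)}` (`k ∈ κ ⊕ κ`) [in print (3.44)
for `U` with `N = B′₀(ε)(‖λ‖_ε^{ξ′}(L^{j′}η)^ε + |λ|)`]: (v) `|(D_lG(U)D_sλ)(z)| ≦ Ne^{−δ₀d}` ⟹ `|(D_lG(U′U)D_sλ)(x)| ≦ B(N + M)e^{−(δ₀/7)d(y_x,y′)}`; (vi) for every
`ℝ`-linear `𝔸`-valued `Φ` anchored at `y ∋ p₀`, `γ`, `B_h, c_ζ ≧ 0` with the (3.43)-left datum `‖Φ(D_lG(U)ν)‖ ≦ B_h(Lʲη)^{1−γ}c_ζe^{−δ₀d(y,y″)}|ν|` for `U` and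
every `N₂ ≧ 0` with `‖Φ(D_lG(U)D_sλ)‖ ≦ N₂e^{−δ₀d(y,y′)}` [(3.45) for `U`]: `‖Φ(D_lG(U′U)D_sλ)‖ ≦ B(N₂ + B_h(Lʲη)^{1−γ}c_ζ(Lʲη)⁻¹(N + M))e^{−(δ₀/7)d(y,y′)}` —
the printed shapes of (3.44)/(3.45) «with different constants only».  PROOF: §2 at FILE 20's cascade (letters at `δ₀/5`, composites at `9δ₀/50`, outer
composition at `(δ₀, 1/100)` from the rate `δ₀/6` to `δ₀/7`); inputs: FILE 28's left-entry clause (`D_lG(U′U) ≺ BLʲηe^{−(δ₀/6)d}`), FILE 36 (iii) (the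
(3.43)-left member of `G(U′U)` for `Φ∘D_l`), FILE 25 §3 ((3.77), its `C⁻¹(U′U)` identified with FILE 28's), `B9Ineq385VG.ineq383_op` ((3.83)),
`B9Eq376POneLetters.eq376_concrete` ((3.76)), `B9Eq386Neumann.eq384_sub` ((3.84)), the gen-11 identifications of the concrete `V₃(A)`
(`conj_V₃Op_eq_gradForm/_eq_vThree`, `conj_lapDDLetter_prodCfg`, `hasMajorant_V₃_zero/one`); FILE 36's `C⁻¹(U′U)`, `G(U′U)` identified with FILE 28's
(`left_inv_eq_right_inv`); the clause constants bounded below a threshold by continuity at `α₁ = 0` (`exists_bound_of_continuousAt`).  HONEST SCOPE: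
module header (a)–(e).
[cite: Balaban1985BackgroundPropagators, Thm 3.4 p.400 + Thm 3.1 (3.42)–(3.45) pp.397–398 + Thm 3.3 p.399 + (3.73) p.405 + (3.76)–(3.77) pp.405–406 + (3.82)–(3.86) p.407 + (3.37)/(3.35) p.396; Balaban1984PropagatorsII, (2.51)–(2.55) p.232 + Lemma 2.1 p.234; Balaban1985Variational, (135) p.298] -/
theorem thm34_all_holderInput_final [Fintype S] [DecidableEq S] [DecidableEq ι] [DecidableEq g.Site] [Nonempty g.Site] (blk : S → g.Site) (d : ℕ)
    (δ₀ B₀ κQ BG B₁ cF Cq a₀ C₀ d₀ M₂ κQb cFb abar : ℝ)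
    (kQ : g.Site → S → 𝔸 →L[ℝ] 𝔸) (sQ : S → 𝔸 →L[ℝ] 𝔸) (cfun w : g.Site → ℝ)
    (hB₀ : 0 ≤ B₀) (hκQ : 0 < κQ) (hBG : 0 < BG) (hB₁ : 0 < B₁) (hcF : 0 < cF) (hCq : 0 ≤ Cq) (ha₀ : 0 ≤ a₀) (hC₀ : 0 ≤ C₀)
    (hM₂ : 0 ≤ M₂) (hδ₀ : 0 < δ₀) (hκQb : 0 ≤ κQb) (hcFb : 0 ≤ cFb) (habar : 0 ≤ abar)
    -- the multiscale geometry 𝔅 (p. 393, [4] (2.1)–(2.4)) and its axioms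
    (hdnn : ∀ a a' : g.Site, 0 ≤ g.dist a a') (htri : Triangle254 (toB6 g Rr H)) (hrefl : ∀ y : g.Site, g.dist y y = 0)
    (hsym : ∀ y y' : g.Site, g.dist y y' = g.dist y' y) (hlen : ∀ y : g.Site, 0 < g.len y) (hlenη : ∀ y : g.Site, g.eta ≤ g.len y)
    (hη : 0 < g.eta) (hL : 1 ≤ g.L)
    -- [4] Lemma 2.1 (2.61) at the rate `δ₀`, «for every 0 < α < 1»
    (h261 : ∀ α : ℝ, 0 < α → α < 1 → Ineq261 d (toB6 g Rr H) δ₀ α)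
    -- p. 398: «Using Lemma 2.1 in [4] we may replace the factor (Lʲη)^α by (Lʲη)^β(L^{j′}η)^γ with β + γ = α» — for every exponent, one
    -- constant `Λ(α) ≧ 1` for the six weights `(Lʲη)^{1,2,−1,−2,−4}` (natural and real powers)
    (hST : ∀ α : ℝ, 0 < α → ∃ Λ : ℝ, 1 ≤ Λ ∧ ScaleTransfer g δ₀ α Λ (fun a => g.len a) ∧ ScaleTransfer g δ₀ α Λ (fun a => g.len a ^ 2) ∧
      ScaleTransfer g δ₀ α Λ (fun a => (g.len a)⁻¹) ∧ ScaleTransfer g δ₀ α Λ (fun a => (g.len a ^ 2)⁻¹) ∧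
      ScaleTransfer g δ₀ α Λ (fun a => (g.len a ^ 4)⁻¹) ∧ ScaleTransfer g δ₀ α Λ (fun y => g.len y ^ (-(4 : ℝ))))
    -- real coordinates of `𝔸`, commuting translations, unitary-type background
    (hrepr : ∀ (v : 𝔸) (i : ι), |b.repr v i| ≤ M₂ * ‖v‖) (hT : ∀ (μ ν : κ) (x : S), T μ (T ν x) = T ν (T μ x))
    (hU1 : ∀ m z, ‖((U m z : 𝔸ˣ) : 𝔸)‖ ≤ 1 ∧ ‖(((U m z)⁻¹ : 𝔸ˣ) : 𝔸)‖ ≤ 1)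
    -- (3.35) on the plaquettes through each bond, at that bond's block scale; stencil geometry at range `d₀`
    (h35 : ∀ μ x m n y, Through T μ x m n y → ‖(plaqU T U m n y : 𝔸) - 1‖ ≤ C₀ * ((g.L ^ g.scale (blk x))⁻¹) ^ 2)
    (hd₀B : ∀ μ x, g.dist (blk x) (blk ((T μ).symm x)) ≤ d₀) (hd₀F : ∀ μ x, g.dist (blk x) (blk (T μ x)) ≤ d₀)
    (hd₀FB : ∀ μ ν x, g.dist (blk x) (blk ((T ν).symm (T μ x))) ≤ d₀)
    (hd₀st : ∀ μ x (q : κ × S), q ∈ stBonds T μ x → g.dist (blk x) (blk q.2) ≤ d₀)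
    (hd₀loc : ∀ μ x (q : κ × S), q ∈ B9Eq375Locality.locBondsA' T μ x → g.dist (blk x) (blk q.2) ≤ d₀)
    (hd₀0 : ∀ y : g.Site, g.dist y y ≤ d₀)
    -- the `A`-independent data of the concrete `V′(A)` of (3.60): (3.19) kernels/multipliers and the `a`-weights of (3.24)
    (hw : ∀ y, 0 ≤ w y) (hcard : ∀ y, ((B9Eq360Vprime.block blk y).card : ℝ) * w y ≤ 1)
    (hkQ : ∀ y x, blk x = y → ‖kQ y x‖ ≤ w y) (hsQ : ∀ x, ‖sQ x‖ ≤ 1) (hcfun : ∀ y, |cfun y| ≤ a₀ * (g.len y ^ 2)⁻¹)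
    -- THEOREM 3.1 for `G′(U)`: (3.42)₁,₂,₃ at the rate `δ₀`
    {Gp : Module.End ℝ (S × ι → ℝ)}
    (h342_1 : HasMajorant (g := toB6 g Rr H) (fun p : S × ι => blk p.1) Gp
      (fun a a' => BG * g.len a ^ 2 * Real.exp (-(δ₀ * g.dist a a'))))
    (h342_2 : ∀ k : κ ⊕ κ, HasMajorant (g := toB6 g Rr H) (fun p : S × ι => blk p.1)
      (conj b (diffLetter T U ((g.eta : ℂ)⁻¹) k) * Gp) (fun a a' => BG * g.len a * Real.exp (-(δ₀ * g.dist a a'))))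
    (h342_3 : ∀ k : κ ⊕ κ, HasMajorant (g := toB6 g Rr H) (fun p : S × ι => blk p.1)
      (Gp * conj b (diffLetter T U ((g.eta : ℂ)⁻¹) k)) (fun a a' => BG * g.len a * Real.exp (-(δ₀ * g.dist a a'))))
    -- (3.24): `G′(U) = (Δ′_a(U))⁻¹` for the letter `Δ′_a(U)`
    {Δp : Module.End ℝ (S × ι → ℝ)} (hΔpGp : Δp * Gp = 1) (hGpΔp : Gp * Δp = 1)
    -- the (3.19) letters `Q′(U)`, `Q′*(U)` in their own typing with block-local two-space majorants, a section of the block map (FILE 17)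
    (rep : g.Site → S × ι) (hrep : ∀ y : g.Site, blk (rep y).1 = y)
    {Qc : (S × ι → ℝ) →ₗ[ℝ] (g.Site → ℝ)} {Qcs : (g.Site → ℝ) →ₗ[ℝ] (S × ι → ℝ)} {Linv : Module.End ℝ (g.Site → ℝ)}
    (hQc : HasMajorantHom (g := toB6 g Rr H) (fun p : S × ι => blk p.1) (fun y : g.Site => y) Qc
      (fun a a' : g.Site => κQ * (if a = a' then (1 : ℝ) else 0)))
    (hQcs : HasMajorantHom (g := toB6 g Rr H) (fun y : g.Site => y) (fun p : S × ι => blk p.1) Qcs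
      (fun a a' : g.Site => κQ * (if a = a' then (1 : ℝ) else 0)))
    -- THEOREM 3.2 for `U`: (3.21) `C⁻¹ = (Q′G′²Q′*)⁻¹` exists (`hLinv`) with the KERNEL bound (3.48) at the rate `δ₀`
    (hLinv : (Qc ∘ₗ (Gp * Gp) ∘ₗ Qcs) * Linv = 1)
    (h348 : ∀ y y' : g.Site, |B9Thm34Inv.ker (B9Thm34Inv.vol g d) Linv y y'| ≤
      B₁ * g.len y ^ (-(4 : ℝ)) * g.len y' ^ (-(d : ℝ)) * Real.exp (-(δ₀ * g.dist y y')))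
    -- the (3.15) bond letters `Q(U)`, `Q*(U)` and the weight letter `a` of (3.24)/(3.26), with their majorants
    {G Qs Q a : Module.End ℝ ((κ × S) × ι → ℝ)}
    (hQb : HasMajorant (g := toB6 g Rr H) (fun q : (κ × S) × ι => blk q.1.2) Q (fun a a' => κQb * Real.exp (-(δ₀ * g.dist a a'))))
    (hQsb : HasMajorant (g := toB6 g Rr H) (fun q : (κ × S) × ι => blk q.1.2) Qs (fun a a' => κQb * Real.exp (-(δ₀ * g.dist a a'))))
    (ha324 : HasMajorant (g := toB6 g Rr H) (fun q : (κ × S) × ι => blk q.1.2) a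
      (fun a a' : g.Site => if a = a' then abar * (g.len a ^ 2)⁻¹ else 0))
    -- THEOREM 3.3 for `G(U)`: two-sided inverse of the concrete `Δ_a(U)` and its (3.42)-entries at the rate `δ₀`
    (hΔG : deltaA (conj b (lapDDLetter T ((g.eta : ℂ)⁻¹) U)) (conj b (dPrimeLetter T U g.eta))
      (conjHom b (gradLin T ((g.eta : ℂ)⁻¹) U) ∘ₗ (1 - (Gp ∘ₗ Qcs ∘ₗ Linv ∘ₗ Qc ∘ₗ Gp)) ∘ₗ conjHom b (divLin T ((g.eta : ℂ)⁻¹) U)) Qs a Q * G = 1)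
    (hGΔ : G * deltaA (conj b (lapDDLetter T ((g.eta : ℂ)⁻¹) U)) (conj b (dPrimeLetter T U g.eta))
      (conjHom b (gradLin T ((g.eta : ℂ)⁻¹) U) ∘ₗ (1 - (Gp ∘ₗ Qcs ∘ₗ Linv ∘ₗ Qc ∘ₗ Gp)) ∘ₗ conjHom b (divLin T ((g.eta : ℂ)⁻¹) U)) Qs a Q = 1)
    (hG : HasMajorant (g := toB6 g Rr H) (fun q : (κ × S) × ι => blk q.1.2) G
      (fun a a' => B₀ * g.len a ^ 2 * Real.exp (-(δ₀ * g.dist a a'))))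
    (hDG : ∀ k : κ ⊕ κ, HasMajorant (g := toB6 g Rr H) (fun q : (κ × S) × ι => blk q.1.2)
      (conj b (diffLetter (bT T) (bU U) ((g.eta : ℂ)⁻¹) k) * G) (fun a a' => B₀ * g.len a * Real.exp (-(δ₀ * g.dist a a'))))
    (hGD : ∀ k : κ ⊕ κ, HasMajorant (g := toB6 g Rr H) (fun q : (κ × S) × ι => blk q.1.2)
      (G * conj b (diffLetter (bT T) (bU U) ((g.eta : ℂ)⁻¹) k)) (fun a a' => B₀ * g.len a * Real.exp (-(δ₀ * g.dist a a'))))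
    -- (kernel form, FILE 28): Theorem 3.3's (3.42)₁,₂,₃,₄ for `G(U)` as PRINTED KERNEL BOUNDS (pairing weight `c = η^d`, volume weight `v(y′) = (L^j′ η)^d`)
    {v : g.Site → ℝ} (hv : ∀ y, 0 < v y) {c : ℝ} (hc : 0 < c)
    (hGk : HasKernelBound (g := toB6 g Rr H) (fun q : (κ × S) × ι => blk q.1.2) v c G
      (fun a a' => B₀ * g.len a ^ 2 * Real.exp (-(δ₀ * g.dist a a'))))
    (hDGk : ∀ k : κ ⊕ κ, HasKernelBound (g := toB6 g Rr H) (fun q : (κ × S) × ι => blk q.1.2) v c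
      (conj b (diffLetter (bT T) (bU U) ((g.eta : ℂ)⁻¹) k) * G) (fun a a' => B₀ * g.len a * Real.exp (-(δ₀ * g.dist a a'))))
    (hGDk : ∀ l : κ ⊕ κ, HasKernelBound (g := toB6 g Rr H) (fun q : (κ × S) × ι => blk q.1.2) v c
      (G * conj b (diffLetter (bT T) (bU U) ((g.eta : ℂ)⁻¹) l)) (fun a a' => B₀ * g.len a * Real.exp (-(δ₀ * g.dist a a'))))
    (hDGDk : ∀ k l : κ ⊕ κ, HasKernelBound (g := toB6 g Rr H) (fun q : (κ × S) × ι => blk q.1.2) v c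
      (conj b (diffLetter (bT T) (bU U) ((g.eta : ℂ)⁻¹) k) * G * conj b (diffLetter (bT T) (bU U) ((g.eta : ℂ)⁻¹) l)) (fun a a' => B₀ * Real.exp (-(δ₀ * g.dist a a'))))
    -- (FILE 34) Theorem 3.1/3.3's `B₀` is positive (p. 397 «positive constants M₁, δ₀, a₀, B₀»)
    (hB₀' : 0 < B₀) :
    ∃ a₁ : ℝ, 0 < a₁ ∧ ∃ B : ℝ, 0 ≤ B ∧
    ∀ (α₁ : ℝ), 0 ≤ α₁ → α₁ ≤ a₁ →
    -- the exponent field `A` in the domain (3.37), read blockwise in the shapes of FILES 1–19, and the `A`-dependent (3.59) data `kF`, `sF`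
    ∀ (A : κ → S → 𝔸) (kF : g.Site → S → 𝔸 →L[ℝ] 𝔸) (sF : S → 𝔸 →L[ℝ] 𝔸),
      (∀ y x, blk x = y → ‖kF y x‖ ≤ Cq * α₁ * w y) → (∀ x, ‖sF x‖ ≤ Cq * α₁) →
      (∀ ν k x, ‖((g.eta : ℂ)⁻¹) • covDstar T U ν (A k) x‖ ≤ α₁ * (g.len (blk x) ^ 2)⁻¹) →
      (∀ μ ν x, ‖((g.eta : ℂ)⁻¹) • covD T U μ (A ν) x‖ ≤ α₁ * (g.len (blk x) ^ 2)⁻¹) →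
      (∀ μ ν x, ‖((g.eta : ℂ)⁻¹) • covDstar T U ν (A ν) (T μ x)‖ ≤ α₁ * (g.len (blk x) ^ 2)⁻¹) →
      (∀ μ x, ‖((g.eta : ℂ)⁻¹) • covDstar T U μ (tauB T U μ (A μ)) x‖ ≤ α₁ * (g.len (blk x) ^ 2)⁻¹) →
      (∀ μ ν k x, ‖((g.eta : ℂ)⁻¹) • covD T U μ (A k) ((T ν).symm x)‖ ≤ α₁ * (g.len (blk x) ^ 2)⁻¹) →
      (∀ k x, ‖A k x‖ ≤ α₁ * (g.len (blk x))⁻¹) → (∀ ν k x, ‖tauB T U ν (A k) x‖ ≤ α₁ * (g.len (blk x))⁻¹) →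
      (∀ μ k x, ‖tauF T U μ (A k) x‖ ≤ α₁ * (g.len (blk x))⁻¹) →
      (∀ k μ ν x, ‖A k ((T ν).symm (T μ x))‖ ≤ α₁ * (g.len (blk x))⁻¹) →
      (∀ μ x m z, (m, z) ∈ stBonds T μ x → ‖A m z‖ ≤ α₁ * (g.len (blk x))⁻¹) →
      (∀ μ x m z, (m, z) ∈ B9Eq375Locality.locBondsA T μ x → ‖A m z‖ ≤ α₁ * (g.len (blk x))⁻¹) →
      (∀ μ x m n y, Through T μ x m n y →
        ‖covD T U m (A n) y‖ ≤ g.eta * (α₁ * ((g.len (blk x))⁻¹) ^ 2) ∧ ‖covD T U n (A m) y‖ ≤ g.eta * (α₁ * ((g.len (blk x))⁻¹) ^ 2)) →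
    -- the (3.57)/(3.59) letters `F′₂(A)`, `F′₂*(A)` (block-local, size `c_F α₁`)
    ∀ {Qc' Fc : (S × ι → ℝ) →ₗ[ℝ] (g.Site → ℝ)} {Qcs' Fcs : (g.Site → ℝ) →ₗ[ℝ] (S × ι → ℝ)},
      Qc' = Qc + Fc → Qcs' = Qcs + Fcs →
      HasMajorantHom (g := toB6 g Rr H) (fun p : S × ι => blk p.1) (fun y : g.Site => y) Fc
        (fun a a' : g.Site => cF * α₁ * (if a = a' then (1 : ℝ) else 0)) →
      HasMajorantHom (g := toB6 g Rr H) (fun y : g.Site => y) (fun p : S × ι => blk p.1) Fcs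
        (fun a a' : g.Site => cF * α₁ * (if a = a' then (1 : ℝ) else 0)) →
    -- the (3.80)–(3.81) letters `F₂(A)`, `F₂*(A)` («|F₂(A)|, |F₂*(A)| ≦ O(1)α₁»), `P₂(A)` of (3.82)
    ∀ {P₂ Qs' Q' F₂ F₂s : Module.End ℝ ((κ × S) × ι → ℝ)},
      Q' = Q + F₂ → Qs' = Qs + F₂s → P₂ = pTwo Qs Q F₂ F₂s a →
      HasMajorant (g := toB6 g Rr H) (fun q : (κ × S) × ι => blk q.1.2) F₂ (fun a a' => cFb * α₁ * Real.exp (-(δ₀ * g.dist a a'))) →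
      HasMajorant (g := toB6 g Rr H) (fun q : (κ × S) × ι => blk q.1.2) F₂s (fun a a' => cFb * α₁ * Real.exp (-(δ₀ * g.dist a a'))) →
    ∃ (Tinv : Module.End ℝ (g.Site → ℝ)) (GExt : Module.End ℝ ((κ × S) × ι → ℝ)),
      -- (ii) `C⁻¹(U′U)` = THE two-sided inverse of `Q′(U′U)G′²(U′U)Q′*(U′U)` (FILE 28, re-exported)
      Tinv * (Qc' ∘ₗ ((gPrimeExtEnd Gp (conj b (vPrimeConc T U g.eta A blk kQ kF sQ sF cfun) * Gp)) * (gPrimeExtEnd Gp (conj b (vPrimeConc T U g.eta A blk kQ kF sQ sF cfun) * Gp))) ∘ₗ Qcs') = 1 ∧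
      (Qc' ∘ₗ ((gPrimeExtEnd Gp (conj b (vPrimeConc T U g.eta A blk kQ kF sQ sF cfun) * Gp)) * (gPrimeExtEnd Gp (conj b (vPrimeConc T U g.eta A blk kQ kF sQ sF cfun) * Gp))) ∘ₗ Qcs') * Tinv = 1 ∧
      -- (iii) `G(U′U)` = THE two-sided inverse of the concrete `Δ_a(U′U)` built with this `C⁻¹(U′U)` (FILE 28, re-exported)
      deltaA (conj b (lapDDLetter T ((g.eta : ℂ)⁻¹) (prodCfg U g.eta A)))
          (conj b (dPrimeLetter T (prodCfg U g.eta A) g.eta))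
          (conjHom b (gradLin T ((g.eta : ℂ)⁻¹) (prodCfg U g.eta A)) ∘ₗ (1 - ((Gp ∘ₗ Qcs ∘ₗ Linv ∘ₗ Qc ∘ₗ Gp) + (B9Eq360Vprime.pPrime Gp (gPrimeExtEnd Gp (conj b (vPrimeConc T U g.eta A blk kQ kF sQ sF cfun) * Gp)) (Qcs ∘ₗ secRes rep) (Qcs' ∘ₗ secRes rep) (secConj rep Linv) (secConj rep Tinv) (secExt rep ∘ₗ Qc) (secExt rep ∘ₗ Qc'))))
            ∘ₗ conjHom b (divLin T ((g.eta : ℂ)⁻¹) (prodCfg U g.eta A))) Qs' a Q' * GExt = 1 ∧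
      GExt *
      deltaA (conj b (lapDDLetter T ((g.eta : ℂ)⁻¹) (prodCfg U g.eta A)))
          (conj b (dPrimeLetter T (prodCfg U g.eta A) g.eta))
          (conjHom b (gradLin T ((g.eta : ℂ)⁻¹) (prodCfg U g.eta A)) ∘ₗ (1 - ((Gp ∘ₗ Qcs ∘ₗ Linv ∘ₗ Qc ∘ₗ Gp) + (B9Eq360Vprime.pPrime Gp (gPrimeExtEnd Gp (conj b (vPrimeConc T U g.eta A blk kQ kF sQ sF cfun) * Gp)) (Qcs ∘ₗ secRes rep) (Qcs' ∘ₗ secRes rep) (secConj rep Linv) (secConj rep Tinv) (secExt rep ∘ₗ Qc) (secExt rep ∘ₗ Qc'))))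
            ∘ₗ conjHom b (divLin T ((g.eta : ℂ)⁻¹) (prodCfg U g.eta A))) Qs' a Q' = 1 ∧
      -- (v) NEW: Theorem 3.3's (3.44)-type member (input Hölder norm, sup output) of THIS `G(U′U)`, for every pair of letters `D_l` (left, with
      -- the (3.42)₂-type entry `D_lG(U) ≺ B₀Lʲηe^{−δ₀d}`) and `D_s` (right, with the (3.42)₃-type entry `G(U)D_s ≺ B₀Lʲηe^{−δ₀d}`)
      (∀ (Dl Ds : Module.End ℝ ((κ × S) × ι → ℝ)),
        HasMajorant (g := toB6 g Rr H) (fun q : (κ × S) × ι => blk q.1.2) (Dl * G) (fun a a' => B₀ * g.len a * Real.exp (-(δ₀ * g.dist a a'))) →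
        HasMajorant (g := toB6 g Rr H) (fun q : (κ × S) × ι => blk q.1.2) (G * Ds) (fun a a' => B₀ * g.len a * Real.exp (-(δ₀ * g.dist a a'))) →
      ∀ (y' : g.Site) (μ : (κ × S) × ι → ℝ) (M : ℝ), BlockSupp (g := toB6 g Rr H) (fun q : (κ × S) × ι => blk q.1.2) μ y' M →
      ∀ (N : ℝ), 0 ≤ N →
        -- (3.44) FOR `U`, THIS INPUT: the mixed second differences of `G(U)λ` (in print `N = B′₀(ε)(‖λ‖_ε^{ξ′}(L^{j′}η)^ε + |λ|)`)
        (∀ (k : κ ⊕ κ) (z : (κ × S) × ι), |(((conj b (diffLetter (bT T) (bU U) ((g.eta : ℂ)⁻¹) k)) * G * Ds) μ) z| ≤ N * Real.exp (-(δ₀ * g.dist (blk z.1.2) y'))) →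
        (∀ z : (κ × S) × ι, |((Dl * G * Ds) μ) z| ≤ N * Real.exp (-(δ₀ * g.dist (blk z.1.2) y'))) →
        ∀ x : (κ × S) × ι, |((Dl * GExt * Ds) μ) x| ≤ B * (N + M) * Real.exp (-(δ₀ / 7 * g.dist (blk x.1.2) y'))) ∧
      -- (vi) NEW: Theorem 3.3's (3.45)-type member (input Hölder norm, Hölder output through a transported quotient functional `Φ`, FILE 34 §3)
      (∀ (Dl Ds : Module.End ℝ ((κ × S) × ι → ℝ)),
        HasMajorant (g := toB6 g Rr H) (fun q : (κ × S) × ι => blk q.1.2) (Dl * G) (fun a a' => B₀ * g.len a * Real.exp (-(δ₀ * g.dist a a'))) →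
        HasMajorant (g := toB6 g Rr H) (fun q : (κ × S) × ι => blk q.1.2) (G * Ds) (fun a a' => B₀ * g.len a * Real.exp (-(δ₀ * g.dist a a'))) →
      ∀ (Φ : (κ × S → 𝔸) →ₗ[ℝ] 𝔸) (y : g.Site) (p₀ : (κ × S) × ι), blk p₀.1.2 = y →
      ∀ (γ Bh cζ : ℝ), 0 ≤ Bh → 0 ≤ cζ →
        -- (3.43) with the derivative `D_l` on the left FOR `U`, this functional
        (∀ (y'' : g.Site) (ν : (κ × S) × ι → ℝ) (C : ℝ), BlockSupp (g := toB6 g Rr H) (fun q : (κ × S) × ι => blk q.1.2) ν y'' C →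
          ‖Φ ((coordEquiv b).symm (Dl (G ν)))‖ ≤ Bh * g.len y ^ (1 - γ) * cζ * Real.exp (-(δ₀ * g.dist y y'')) * C) →
      ∀ (y' : g.Site) (μ : (κ × S) × ι → ℝ) (M : ℝ), BlockSupp (g := toB6 g Rr H) (fun q : (κ × S) × ι => blk q.1.2) μ y' M →
      ∀ (N : ℝ), 0 ≤ N →
        (∀ (k : κ ⊕ κ) (z : (κ × S) × ι), |(((conj b (diffLetter (bT T) (bU U) ((g.eta : ℂ)⁻¹) k)) * G * Ds) μ) z| ≤ N * Real.exp (-(δ₀ * g.dist (blk z.1.2) y'))) →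
      -- (3.45) FOR `U`, THIS INPUT AND THIS FUNCTIONAL (in print `N₂ = B′₀(ε,β)(Lʲη)^{−β}(‖ζ‖_β^ξ + |ζ|)(…)`)
      ∀ (N₂ : ℝ), 0 ≤ N₂ → ‖Φ ((coordEquiv b).symm ((Dl * G * Ds) μ))‖ ≤ N₂ * Real.exp (-(δ₀ * g.dist y y')) →
        ‖Φ ((coordEquiv b).symm ((Dl * GExt * Ds) μ))‖ ≤
          B * (N₂ + Bh * g.len y ^ (1 - γ) * cζ * (g.len y)⁻¹ * (N + M)) * Real.exp (-(δ₀ / 7 * g.dist y y'))) := by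
  classical
  obtain ⟨y₀⟩ := ‹Nonempty g.Site›
  -- FILE 28 (identities, left-entry operator clause), FILE 36 (the (3.43)-left member of `G(U′U)` per functional), FILE 25 §3 ((3.77))
  obtain ⟨a₁, ha₁, B', hB', H28⟩ := thm34_all_final (Rr := Rr) (H := H) b T U blk d δ₀ B₀ κQ BG B₁ cF Cq a₀ C₀ d₀ M₂ κQb cFb abar kQ sQ
    cfun w hB₀ hκQ hBG hB₁ hcF hCq ha₀ hC₀ hM₂ hδ₀ hκQb hcFb habar hdnn htri hrefl hsym hlen hlenη hη hL h261 hST hrepr hT hU1 h35 hd₀B hd₀F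
    hd₀FB hd₀st hd₀loc hd₀0 hw hcard hkQ hsQ hcfun h342_1 h342_2 h342_3 hΔpGp hGpΔp rep hrep hQc hQcs hLinv h348 hQb hQsb ha324 hΔG hGΔ hG hDG
    hGD hv hc hGk hDGk hGDk hDGDk
  obtain ⟨a₃, ha₃, B₃, hB₃, H36⟩ := thm34_all_holder_final (Rr := Rr) (H := H) b T U blk d δ₀ B₀ κQ BG B₁ cF Cq a₀ C₀ d₀ M₂ κQb cFb abar
    kQ sQ cfun w hB₀ hκQ hBG hB₁ hcF hCq ha₀ hC₀ hM₂ hδ₀ hκQb hcFb habar hdnn htri hrefl hsym hlen hlenη hη hL h261 hST hrepr hT hU1 h35 hd₀B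
    hd₀F hd₀FB hd₀st hd₀loc hd₀0 hw hcard hkQ hsQ hcfun h342_1 h342_2 h342_3 hΔpGp hGpΔp rep hrep hQc hQcs hLinv h348 hQb hQsb ha324 hΔG hGΔ
    hG hDG hGD hv hc hGk hDGk hGDk hDGDk hB₀'
  obtain ⟨a₂, ha₂, K, hK, H2⟩ := exists_threshold_pOne (Rr := Rr) (H := H) b T U blk d δ₀ κQ BG B₁ cF Cq a₀ d₀ M₂ kQ sQ cfun w hκQ hBG hB₁
    hcF hCq ha₀ hM₂ hδ₀ hdnn htri hrefl hsym hlen hlenη hη h261 hST hrepr hU1 hd₀B hd₀F hd₀0 hw hcard hkQ hsQ hcfun h342_1 h342_2 h342_3 rep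
    hrep hQc hQcs hLinv h348
  -- the geometry of the cascade: exponents `1/100` at the printed rate `δ₀` (inner compositions and the outer one)
  obtain ⟨Λ, hΛ, hT1, -, hT1i, hT2i, -, -⟩ := hST (1 / 100) (by norm_num)
  have hΛ0 : 0 ≤ Λ := zero_le_one.trans hΛ
  have h261β : Ineq261 d (toB6 g Rr H) δ₀ (1 / 100) := h261 _ (by norm_num) (by norm_num)
  have hc₂ : 0 ≤ B6.c1 d δ₀ (1 / 100) := B6RandomWalk.c1_nonneg d δ₀ (1 / 100)
  have hδ5 : (0 : ℝ) ≤ 1 / 5 * δ₀ := by linarith only [hδ₀]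
  have hρ0 : (0 : ℝ) ≤ 9 / 50 * δ₀ := by linarith only [hδ₀]
  have hr : 9 / 50 * δ₀ + (1 / 100 + 1 / 100) * δ₀ ≤ 1 / 5 * δ₀ := by linarith only [hδ₀]
  have hrP : 1 / 5 * δ₀ + (1 / 100 + 1 / 100) * δ₀ ≤ δ₀ := by linarith only [hδ₀]
  have h15 : 1 / 5 * δ₀ ≤ δ₀ := by linarith only [hδ₀]
  have hρ₃ : (0 : ℝ) ≤ δ₀ / 7 := by linarith only [hδ₀]
  have hρ₃r : δ₀ / 7 + (1 / 100 + 1 / 100) * δ₀ ≤ δ₀ / 6 := by linarith only [hδ₀]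
  have hρ₃ρ : δ₀ / 7 ≤ 9 / 50 * δ₀ := by linarith only [hδ₀]
  -- «of course with different constants» (p. 403): the two clause constants are continuous at `α₁ = 0`, hence bounded below a threshold
  obtain ⟨KB₁, ε₁, hKB₁, hε₁, hF1⟩ := exists_bound_of_continuousAt
    (f := fun α₁ : ℝ => (1 + α₁ * B' * Λ * (B6.c1 d δ₀ (1 / 100)) * (cV385 (Fintype.card κ) α₁ C₀ (M₂ * (∑ i, ‖b i‖) * Real.exp (1 / 5 * δ₀ * d₀))) * (B6.c1 d δ₀ (1 / 100))) + (α₁ * B' * Λ * (B6.c1 d δ₀ (1 / 100)) * B₀ * Λ * (B6.c1 d δ₀ (1 / 100)) * ((cV385 (Fintype.card κ) α₁ C₀ (M₂ * (∑ i, ‖b i‖) * Real.exp (1 / 5 * δ₀ * d₀))) + K + (kappa383 κQb cFb abar Λ (B6.c1 d δ₀ (1 / 100)) α₁))))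
    (by
      unfold kappa383 cV385 B9Eq382V3Letters.cV0 B9Eq373V3.kΔ B9Eq373V3.kP
      fun_prop)
  obtain ⟨KB₂, ε₂, hKB₂, hε₂, hF2⟩ := exists_bound_of_continuousAt
    (f := fun α₁ : ℝ => 1 + (B₃ * Λ * (B6.c1 d δ₀ (1 / 100)) * (α₁ * (B6.c1 d δ₀ (1 / 100)) * (((cV385 (Fintype.card κ) α₁ C₀ (M₂ * (∑ i, ‖b i‖) * Real.exp (1 / 5 * δ₀ * d₀))) + K + (kappa383 κQb cFb abar Λ (B6.c1 d δ₀ (1 / 100)) α₁)) * B₀ * Λ + (cV385 (Fintype.card κ) α₁ C₀ (M₂ * (∑ i, ‖b i‖) * Real.exp (1 / 5 * δ₀ * d₀)))))))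
    (by
      unfold kappa383 cV385 B9Eq382V3Letters.cV0 B9Eq373V3.kΔ B9Eq373V3.kP
      fun_prop)
  have hBtot : 0 ≤ KB₁ + KB₂ := add_nonneg hKB₁ hKB₂
  refine ⟨min (min (min a₁ a₂) (min a₃ (1 / 4))) (min (ε₁ / 2) (ε₂ / 2)),
    lt_min (lt_min (lt_min ha₁ ha₂) (lt_min ha₃ (by norm_num))) (lt_min (half_pos hε₁) (half_pos hε₂)), KB₁ + KB₂, hBtot, ?_⟩
  intro α₁ hα₁0 hα₁1 A kF sF hkF hsF h337B h337F h337B' h337Bτ h337FB hA hAτB hAτF hAFB hAst hAloc hdAst Qc' Fc Qcs' Fcs h357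
    h357s hFc hFcs P₂ Qs' Q' F₂ F₂s h380 h380s hP₂def hF₂ hF₂s
  have hm₁ : min (min (min a₁ a₂) (min a₃ (1 / 4))) (min (ε₁ / 2) (ε₂ / 2)) ≤ a₁ :=
    (min_le_left _ _).trans ((min_le_left _ _).trans (min_le_left _ _))
  have hm₂ : min (min (min a₁ a₂) (min a₃ (1 / 4))) (min (ε₁ / 2) (ε₂ / 2)) ≤ a₂ :=
    (min_le_left _ _).trans ((min_le_left _ _).trans (min_le_right _ _))
  have hm₃ : min (min (min a₁ a₂) (min a₃ (1 / 4))) (min (ε₁ / 2) (ε₂ / 2)) ≤ a₃ :=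
    (min_le_left _ _).trans ((min_le_right _ _).trans (min_le_left _ _))
  have hmq : min (min (min a₁ a₂) (min a₃ (1 / 4))) (min (ε₁ / 2) (ε₂ / 2)) ≤ 1 / 4 :=
    (min_le_left _ _).trans ((min_le_right _ _).trans (min_le_right _ _))
  have hmε₁ : min (min (min a₁ a₂) (min a₃ (1 / 4))) (min (ε₁ / 2) (ε₂ / 2)) ≤ ε₁ / 2 := (min_le_right _ _).trans (min_le_left _ _)
  have hmε₂ : min (min (min a₁ a₂) (min a₃ (1 / 4))) (min (ε₁ / 2) (ε₂ / 2)) ≤ ε₂ / 2 := (min_le_right _ _).trans (min_le_right _ _)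
  have hα₁a : α₁ ≤ a₁ := hα₁1.trans hm₁
  have hα₁b : α₁ ≤ a₂ := hα₁1.trans hm₂
  have hα₁c : α₁ ≤ a₃ := hα₁1.trans hm₃
  have hα₁q : α₁ ≤ 1 / 4 := hα₁1.trans hmq
  have habs : |α₁| = α₁ := abs_of_nonneg hα₁0
  have hα₁ε₁ : |α₁| < ε₁ := by rw [habs]; linarith only [hα₁1, hmε₁, hε₁]
  have hα₁ε₂ : |α₁| < ε₂ := by rw [habs]; linarith only [hα₁1, hmε₂, hε₂]
  -- FILE 28 at this `α₁`, `A`: `C⁻¹(U′U)`, `G(U′U)`, identities, the left-entry operator clause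
  obtain ⟨-, -, -, -, Tinv, GExt, e1, e2, -, -, -, -, -, -, -, -, -, e3, e4, hGL, -, -, -, -, -⟩ := H28 α₁ hα₁0 hα₁a A kF sF hkF
    hsF h337B h337F h337B' h337Bτ h337FB hA hAτB hAτF hAFB hAst hAloc hdAst h357 h357s hFc hFcs h380 h380s hP₂def hF₂ hF₂s
  -- FILE 36 at this `α₁`, `A`: ITS pair coincides with FILE 28's (uniqueness of two-sided inverses); keep its (3.43)-left clause for `G(U′U)`
  obtain ⟨-, -, -, -, Tinv₃, GExt₃, f1₃, -, -, g2₃, hGLp, -⟩ := H36 α₁ hα₁0 hα₁c A kF sF hkF hsF h337B h337F h337B' h337Bτ h337FB hA hAτB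
    hAτF hAFB hAst hAloc hdAst h357 h357s hFc hFcs h380 h380s hP₂def hF₂ hF₂s
  have hT₃ : Tinv₃ = Tinv := left_inv_eq_right_inv f1₃ e2
  subst Tinv₃
  have hG₃ : GExt₃ = GExt := left_inv_eq_right_inv g2₃ e3
  subst GExt₃
  -- FILE 25 §3 at this `α₁`, `A`: ITS `C⁻¹(U′U)` coincides with FILE 28's, so (3.77) holds for FILE 28's `P₁(A)`
  obtain ⟨Tinv₂, f1, -, hP₁⟩ := H2 α₁ hα₁0 hα₁b A kF sF hkF hsF h337B h337F h337Bτ hA hAτB h357 h357s hFc hFcs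
  have hTT : Tinv₂ = Tinv := left_inv_eq_right_inv f1 e2
  rw [hTT] at hP₁
  -- «η·α₁(Lʲη)⁻¹ ≦ 1/4», the constants of the concrete (3.73) letters at the rate `δ₀/5` (gen 11), (3.83) for `P₂(A)` at `δ₀/5`
  have hsmall : ∀ z : g.Site, g.eta * (α₁ * (g.len z)⁻¹) ≤ 1 / 4 := fun z => by
    have hq : g.eta * (g.len z)⁻¹ ≤ 1 := by
      rw [← div_eq_mul_inv]; exact (div_le_one (hlen z)).mpr (hlenη z)
    calc g.eta * (α₁ * (g.len z)⁻¹) = α₁ * (g.eta * (g.len z)⁻¹) := by ring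
      _ ≤ α₁ * 1 := mul_le_mul_of_nonneg_left hq hα₁0
      _ ≤ 1 / 4 := by linarith only [hα₁q]
  have hMc0 : 0 ≤ (M₂ * (∑ i, ‖b i‖) * Real.exp (1 / 5 * δ₀ * d₀)) := by positivity
  have hcV0 := cV0_nonneg (Fintype.card κ) hα₁0 hC₀
  have hcV : 0 ≤ (cV385 (Fintype.card κ) α₁ C₀ (M₂ * (∑ i, ‖b i‖) * Real.exp (1 / 5 * δ₀ * d₀))) := cV385_nonneg (Fintype.card κ) hα₁0 hC₀ hMc0
  have hκ₂ : 0 ≤ (kappa383 κQb cFb abar Λ (B6.c1 d δ₀ (1 / 100)) α₁) := kappa383_nonneg hκQb hcFb habar hΛ0 hc₂ hα₁0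
  have hV₃ := conj_V₃Op_eq_gradForm T U b g.eta A
  have hV₃' := conj_V₃Op_eq_vThree T U b g.eta A
  have h371 := conj_lapDDLetter_prodCfg (b := b) (T := T) (U := U) hη.ne' A
  have hV0 := hasMajorant_V₃_zero (Rr := Rr) (H := H) b T U blk hη hL A C₀ d₀ (1 / 5 * δ₀) M₂ α₁ hα₁0 hC₀ hδ5 hM₂ hrepr hlen hsmall hU1
    h337B h337F h337B' hAst hAloc hdAst h35 hd₀B hd₀F hd₀FB hd₀st hd₀loc hd₀0
  have hV1 := hasMajorant_V₃_one (Rr := Rr) (H := H) b T U blk A d₀ (1 / 5 * δ₀) M₂ α₁ hα₁0 hδ5 hM₂ hrepr hlen hA hAτB hAτF hU1 hd₀B hd₀F hd₀0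
  have hV0' : HasMajorant (g := toB6 g Rr H) (fun q : (κ × S) × ι => blk q.1.2)
      (conj b (zeroLetter T U ((g.eta : ℂ)⁻¹) A + F₁Letter T U g.eta A)
        - conj b (dPrimeLetter T (prodCfg U g.eta A) g.eta - dPrimeLetter T U g.eta)
        + conj b (zeroLetter₂ T U ((g.eta : ℂ)⁻¹) A + F₂Letter T U g.eta A))
      (fun a a' => (cV385 (Fintype.card κ) α₁ C₀ (M₂ * (∑ i, ‖b i‖) * Real.exp (1 / 5 * δ₀ * d₀))) * α₁ * (g.len a ^ 2)⁻¹ * Real.exp (-(1 / 5 * δ₀ * g.dist a a'))) := by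
    refine hasMajorant_mono (g := toB6 g Rr H) _ hV0 fun z z' => ?_
    have h0' : 0 ≤ 28 * (Fintype.card κ : ℝ) * (Fintype.card κ + 1) * (M₂ * (∑ i, ‖b i‖) * Real.exp (1 / 5 * δ₀ * d₀)) * α₁ * (g.len z ^ 2)⁻¹ *
        Real.exp (-(1 / 5 * δ₀ * g.dist z z')) := by
      positivity
    have e : (cV385 (Fintype.card κ) α₁ C₀ (M₂ * (∑ i, ‖b i‖) * Real.exp (1 / 5 * δ₀ * d₀))) * α₁ * (g.len z ^ 2)⁻¹ * Real.exp (-(1 / 5 * δ₀ * g.dist z z'))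
        = cV0 (Fintype.card κ) α₁ C₀ * M₂ * (∑ i, ‖b i‖) * Real.exp (1 / 5 * δ₀ * d₀) * α₁ * (g.len z ^ 2)⁻¹ *
            Real.exp (-(1 / 5 * δ₀ * g.dist z z'))
          + 28 * (Fintype.card κ : ℝ) * (Fintype.card κ + 1) * (M₂ * (∑ i, ‖b i‖) * Real.exp (1 / 5 * δ₀ * d₀)) * α₁ * (g.len z ^ 2)⁻¹ *
            Real.exp (-(1 / 5 * δ₀ * g.dist z z')) := by
      unfold cV385; ring
    rw [e]
    linarith
  have hsum : ∑ _k ∈ (Finset.univ : Finset (κ ⊕ κ)), (14 * ((Fintype.card κ : ℝ) + 1) * M₂ * (∑ i, ‖b i‖) * Real.exp (1 / 5 * δ₀ * d₀)) ≤ (cV385 (Fintype.card κ) α₁ C₀ (M₂ * (∑ i, ‖b i‖) * Real.exp (1 / 5 * δ₀ * d₀))) := by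
    rw [Finset.sum_const, Finset.card_univ, Fintype.card_sum, nsmul_eq_mul, Nat.cast_add]
    have h0' : 0 ≤ cV0 (Fintype.card κ) α₁ C₀ * (M₂ * (∑ i, ‖b i‖) * Real.exp (1 / 5 * δ₀ * d₀)) := mul_nonneg hcV0 hMc0
    have e : (cV385 (Fintype.card κ) α₁ C₀ (M₂ * (∑ i, ‖b i‖) * Real.exp (1 / 5 * δ₀ * d₀))) = cV0 (Fintype.card κ) α₁ C₀ * (M₂ * (∑ i, ‖b i‖) * Real.exp (1 / 5 * δ₀ * d₀))
          + ((Fintype.card κ : ℝ) + Fintype.card κ) * (14 * ((Fintype.card κ : ℝ) + 1) * M₂ * (∑ i, ‖b i‖) * Real.exp (1 / 5 * δ₀ * d₀)) := by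
      unfold cV385; ring
    rw [e]
    linarith
  have hP₂ : HasMajorant (g := toB6 g Rr H) (fun q : (κ × S) × ι => blk q.1.2) P₂
      (fun a a' => (kappa383 κQb cFb abar Λ (B6.c1 d δ₀ (1 / 100)) α₁) * α₁ * (g.len a ^ 2)⁻¹ * Real.exp (-(1 / 5 * δ₀ * g.dist a a'))) := by
    rw [hP₂def]
    exact ineq383_op (R := Rr) (H := H) (fun q : (κ × S) × ι => blk q.1.2) d δ₀ δ₀ (1 / 100) (1 / 100) (1 / 5 * δ₀) Λ κQb cFb abar α₁ hκQb hcFb habar hα₁0 hΛ0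
      hδ5 (by norm_num) (by norm_num) hδ₀.le hrP hdnn htri h261β hT2i hQb hQsb hF₂ hF₂s ha324
  -- (3.84) for the concrete letters: `Δ_a(U′U) = Δ_a(U) − V(A)`, hence `G(U′U)(Δ_a(U) − V(A)) = 1` from FILE 28's identity
  have h384 : deltaA (conj b (lapDDLetter T ((g.eta : ℂ)⁻¹) (prodCfg U g.eta A)))
        (conj b (dPrimeLetter T (prodCfg U g.eta A) g.eta))
        (conjHom b (gradLin T ((g.eta : ℂ)⁻¹) (prodCfg U g.eta A)) ∘ₗ (1 - ((Gp ∘ₗ Qcs ∘ₗ Linv ∘ₗ Qc ∘ₗ Gp) + (B9Eq360Vprime.pPrime Gp (gPrimeExtEnd Gp (conj b (vPrimeConc T U g.eta A blk kQ kF sQ sF cfun) * Gp)) (Qcs ∘ₗ secRes rep) (Qcs' ∘ₗ secRes rep) (secConj rep Linv) (secConj rep Tinv) (secExt rep ∘ₗ Qc) (secExt rep ∘ₗ Qc'))))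
          ∘ₗ conjHom b (divLin T ((g.eta : ℂ)⁻¹) (prodCfg U g.eta A))) Qs' a Q' =
      deltaA (conj b (lapDDLetter T ((g.eta : ℂ)⁻¹) U)) (conj b (dPrimeLetter T U g.eta))
        (conjHom b (gradLin T ((g.eta : ℂ)⁻¹) U) ∘ₗ (1 - (Gp ∘ₗ Qcs ∘ₗ Linv ∘ₗ Qc ∘ₗ Gp)) ∘ₗ conjHom b (divLin T ((g.eta : ℂ)⁻¹) U)) Qs a Q -
        vTotal (conj b (V₃Op T U g.eta A))
          (((conjHom b (gradLin T ((g.eta : ℂ)⁻¹) (prodCfg U g.eta A)) - conjHom b (gradLin T ((g.eta : ℂ)⁻¹) U))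
              ∘ₗ (Gp ∘ₗ Qcs ∘ₗ Linv ∘ₗ Qc ∘ₗ Gp) ∘ₗ conjHom b (divLin T ((g.eta : ℂ)⁻¹) U)
            + conjHom b (gradLin T ((g.eta : ℂ)⁻¹) U) ∘ₗ (Gp ∘ₗ Qcs ∘ₗ Linv ∘ₗ Qc ∘ₗ Gp)
              ∘ₗ (conjHom b (divLin T ((g.eta : ℂ)⁻¹) (prodCfg U g.eta A)) - conjHom b (divLin T ((g.eta : ℂ)⁻¹) U))
            + (conjHom b (gradLin T ((g.eta : ℂ)⁻¹) (prodCfg U g.eta A)) - conjHom b (gradLin T ((g.eta : ℂ)⁻¹) U))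
              ∘ₗ (Gp ∘ₗ Qcs ∘ₗ Linv ∘ₗ Qc ∘ₗ Gp)
              ∘ₗ (conjHom b (divLin T ((g.eta : ℂ)⁻¹) (prodCfg U g.eta A)) - conjHom b (divLin T ((g.eta : ℂ)⁻¹) U))
            + conjHom b (gradLin T ((g.eta : ℂ)⁻¹) (prodCfg U g.eta A)) ∘ₗ (B9Eq360Vprime.pPrime Gp (gPrimeExtEnd Gp (conj b (vPrimeConc T U g.eta A blk kQ kF sQ sF cfun) * Gp)) (Qcs ∘ₗ secRes rep) (Qcs' ∘ₗ secRes rep) (secConj rep Linv) (secConj rep Tinv) (secExt rep ∘ₗ Qc) (secExt rep ∘ₗ Qc'))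
              ∘ₗ conjHom b (divLin T ((g.eta : ℂ)⁻¹) (prodCfg U g.eta A))))
          P₂ := by
    rw [eq384_sub (conj b (lapDDLetter T ((g.eta : ℂ)⁻¹) U)) (conj b (lapDDLetter T ((g.eta : ℂ)⁻¹) (prodCfg U g.eta A)))
      (conj b (dPrimeLetter T U g.eta)) (conj b (dPrimeLetter T (prodCfg U g.eta A) g.eta)) _ _ Qs Qs' Q Q' a
      (conj b (V₁Op T U g.eta A)) (conj b (V₂Op T U g.eta A)) _ F₂ F₂s h371
      (eq376_concrete T U b hη.ne' A (Gp ∘ₗ Qcs ∘ₗ Linv ∘ₗ Qc ∘ₗ Gp) (B9Eq360Vprime.pPrime Gp (gPrimeExtEnd Gp (conj b (vPrimeConc T U g.eta A blk kQ kF sQ sF cfun) * Gp)) (Qcs ∘ₗ secRes rep) (Qcs' ∘ₗ secRes rep) (secConj rep Linv) (secConj rep Tinv) (secExt rep ∘ₗ Qc) (secExt rep ∘ₗ Qc'))) h380 h380s, hV₃', hP₂def]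
  have hE := e4
  rw [h384] at hE
  -- common non-negativities and the clause constants at this `α₁`
  have hw1 : ∀ a : g.Site, 0 ≤ g.len a := fun a => (hlen a).le
  have hcK0 : ∀ k ∈ (Finset.univ : Finset (κ ⊕ κ)), (0 : ℝ) ≤ (14 * ((Fintype.card κ : ℝ) + 1) * M₂ * (∑ i, ‖b i‖) * Real.exp (1 / 5 * δ₀ * d₀)) := fun k _ => by positivity
  have hK1 := hF1 α₁ hα₁ε₁
  have hK2 := hF2 α₁ hα₁ε₂
  have hcoefN : 0 ≤ (1 + α₁ * B' * Λ * (B6.c1 d δ₀ (1 / 100)) * (cV385 (Fintype.card κ) α₁ C₀ (M₂ * (∑ i, ‖b i‖) * Real.exp (1 / 5 * δ₀ * d₀))) * (B6.c1 d δ₀ (1 / 100))) := by positivity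
  have hcoefM : 0 ≤ (α₁ * B' * Λ * (B6.c1 d δ₀ (1 / 100)) * B₀ * Λ * (B6.c1 d δ₀ (1 / 100)) * ((cV385 (Fintype.card κ) α₁ C₀ (M₂ * (∑ i, ‖b i‖) * Real.exp (1 / 5 * δ₀ * d₀))) + K + (kappa383 κQb cFb abar Λ (B6.c1 d δ₀ (1 / 100)) α₁))) := by positivity
  have hcoefVI : 0 ≤ (B₃ * Λ * (B6.c1 d δ₀ (1 / 100)) * (α₁ * (B6.c1 d δ₀ (1 / 100)) * (((cV385 (Fintype.card κ) α₁ C₀ (M₂ * (∑ i, ‖b i‖) * Real.exp (1 / 5 * δ₀ * d₀))) + K + (kappa383 κQb cFb abar Λ (B6.c1 d δ₀ (1 / 100)) α₁)) * B₀ * Λ + (cV385 (Fintype.card κ) α₁ C₀ (M₂ * (∑ i, ‖b i‖) * Real.exp (1 / 5 * δ₀ * d₀)))))) := by positivity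
  refine ⟨Tinv, GExt, e1, e2, e3, e4, ?_, ?_⟩
  · -- (v) the (3.44)-type member
    intro Dl Ds hDlG hGDs y' μ M hμ N hN h344 h344l x
    have hM : 0 ≤ M := hμ.nonneg
    have hGDs5 := hasMajorant_rate_mono (R := Rr) (H := H) (fun q : (κ × S) × ι => blk q.1.2) B₀ (fun a => g.len a) hB₀ hw1 h15 hdnn hGDs
    have hDlE := hGL Dl (fun a => g.len a) hw1 hDlG
    have hdev := input344_of_inverse (R := Rr) (H := H) (fun q : (κ × S) × ι => blk q.1.2) d (Finset.univ : Finset (κ ⊕ κ))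
      δ₀ (1 / 5 * δ₀) (1 / 100) (1 / 100) (9 / 50 * δ₀) Λ (cV385 (Fintype.card κ) α₁ C₀ (M₂ * (∑ i, ‖b i‖) * Real.exp (1 / 5 * δ₀ * d₀))) K (kappa383 κQb cFb abar Λ (B6.c1 d δ₀ (1 / 100)) α₁) α₁ B₀ δ₀ (1 / 100) (1 / 100) Λ (δ₀ / 6) (δ₀ / 7) B'
      (fun _ => (14 * ((Fintype.card κ : ℝ) + 1) * M₂ * (∑ i, ‖b i‖) * Real.exp (1 / 5 * δ₀ * d₀)))
      hB₀ hcV hK hκ₂ hα₁0 hΛ0 hρ0 (by norm_num) (by norm_num) hδ₀.le hr hcK0 hsum hΛ0 hB' hρ₃ hρ₃r hρ₃ρ hdnn htri hlen h261β h261β hT1 hT1i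
      (V1 := fun k => conj b (V1Letter T U A k) + conj b (V1Letter₂ T U A k))
      (D := fun k => conj b (diffLetter (bT T) (bU U) ((g.eta : ℂ)⁻¹) k))
      hV₃ hΔG hE hV0' (fun k _ => hV1 k) hP₁ hP₂ hGDs5 hDlE y' μ M hμ N hN
      (fun k _ z => (h344 k z).trans (mul_le_mul_of_nonneg_left (exp_rate_mono h15 (hdnn _ _)) hN))
      (fun z => (h344l z).trans (mul_le_mul_of_nonneg_left (exp_rate_mono h15 (hdnn _ _)) hN)) x
    refine hdev.trans ?_
    have hE₀ : 0 ≤ Real.exp (-(δ₀ / 7 * g.dist (blk x.1.2) y')) := Real.exp_nonneg _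
    have h1 : N * (1 + α₁ * B' * Λ * (B6.c1 d δ₀ (1 / 100)) * (cV385 (Fintype.card κ) α₁ C₀ (M₂ * (∑ i, ‖b i‖) * Real.exp (1 / 5 * δ₀ * d₀))) * (B6.c1 d δ₀ (1 / 100))) ≤ N * ((1 + α₁ * B' * Λ * (B6.c1 d δ₀ (1 / 100)) * (cV385 (Fintype.card κ) α₁ C₀ (M₂ * (∑ i, ‖b i‖) * Real.exp (1 / 5 * δ₀ * d₀))) * (B6.c1 d δ₀ (1 / 100))) + (α₁ * B' * Λ * (B6.c1 d δ₀ (1 / 100)) * B₀ * Λ * (B6.c1 d δ₀ (1 / 100)) * ((cV385 (Fintype.card κ) α₁ C₀ (M₂ * (∑ i, ‖b i‖) * Real.exp (1 / 5 * δ₀ * d₀))) + K + (kappa383 κQb cFb abar Λ (B6.c1 d δ₀ (1 / 100)) α₁)))) := mul_le_mul_of_nonneg_left (le_add_of_nonneg_right hcoefM) hN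
    have h2 : M * (α₁ * B' * Λ * (B6.c1 d δ₀ (1 / 100)) * B₀ * Λ * (B6.c1 d δ₀ (1 / 100)) * ((cV385 (Fintype.card κ) α₁ C₀ (M₂ * (∑ i, ‖b i‖) * Real.exp (1 / 5 * δ₀ * d₀))) + K + (kappa383 κQb cFb abar Λ (B6.c1 d δ₀ (1 / 100)) α₁))) ≤ M * ((1 + α₁ * B' * Λ * (B6.c1 d δ₀ (1 / 100)) * (cV385 (Fintype.card κ) α₁ C₀ (M₂ * (∑ i, ‖b i‖) * Real.exp (1 / 5 * δ₀ * d₀))) * (B6.c1 d δ₀ (1 / 100))) + (α₁ * B' * Λ * (B6.c1 d δ₀ (1 / 100)) * B₀ * Λ * (B6.c1 d δ₀ (1 / 100)) * ((cV385 (Fintype.card κ) α₁ C₀ (M₂ * (∑ i, ‖b i‖) * Real.exp (1 / 5 * δ₀ * d₀))) + K + (kappa383 κQb cFb abar Λ (B6.c1 d δ₀ (1 / 100)) α₁)))) := mul_le_mul_of_nonneg_left (le_add_of_nonneg_left hcoefN) hM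
    have h3 : (N + M) * ((1 + α₁ * B' * Λ * (B6.c1 d δ₀ (1 / 100)) * (cV385 (Fintype.card κ) α₁ C₀ (M₂ * (∑ i, ‖b i‖) * Real.exp (1 / 5 * δ₀ * d₀))) * (B6.c1 d δ₀ (1 / 100))) + (α₁ * B' * Λ * (B6.c1 d δ₀ (1 / 100)) * B₀ * Λ * (B6.c1 d δ₀ (1 / 100)) * ((cV385 (Fintype.card κ) α₁ C₀ (M₂ * (∑ i, ‖b i‖) * Real.exp (1 / 5 * δ₀ * d₀))) + K + (kappa383 κQb cFb abar Λ (B6.c1 d δ₀ (1 / 100)) α₁)))) ≤ (N + M) * (KB₁ + KB₂) :=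
      mul_le_mul_of_nonneg_left (hK1.trans (le_add_of_nonneg_right hKB₂)) (add_nonneg hN hM)
    have h4 : N * (1 + α₁ * B' * Λ * (B6.c1 d δ₀ (1 / 100)) * (cV385 (Fintype.card κ) α₁ C₀ (M₂ * (∑ i, ‖b i‖) * Real.exp (1 / 5 * δ₀ * d₀))) * (B6.c1 d δ₀ (1 / 100))) + M * (α₁ * B' * Λ * (B6.c1 d δ₀ (1 / 100)) * B₀ * Λ * (B6.c1 d δ₀ (1 / 100)) * ((cV385 (Fintype.card κ) α₁ C₀ (M₂ * (∑ i, ‖b i‖) * Real.exp (1 / 5 * δ₀ * d₀))) + K + (kappa383 κQb cFb abar Λ (B6.c1 d δ₀ (1 / 100)) α₁))) ≤ (KB₁ + KB₂) * (N + M) := by linarith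
    exact mul_le_mul_of_nonneg_right h4 hE₀
  · -- (vi) the (3.45)-type member
    intro Dl Ds hDlG hGDs Φ y p₀ hp₀ γ Bh cζ hBh hcζ h343 y' μ M hμ N hN h344 N₂ hN₂ h345
    have hM : 0 ≤ M := hμ.nonneg
    have hGDs5 := hasMajorant_rate_mono (R := Rr) (H := H) (fun q : (κ × S) × ι => blk q.1.2) B₀ (fun a => g.len a) hB₀ hw1 h15 hdnn hGDs
    have hA₃ : 0 ≤ B₃ * Bh * g.len y ^ (1 - γ) * cζ := mul_nonneg (mul_nonneg (mul_nonneg hB₃ hBh) (Real.rpow_nonneg (hlen y).le _)) hcζ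
    -- FILE 36 (iii): the (3.43)-left member of `G(U′U)` for the functional `Φ ∘ coord⁻¹ ∘ D_l`
    have hΨE : ∀ (y'' : g.Site) (ν : (κ × S) × ι → ℝ) (C : ℝ), BlockSupp (g := toB6 g Rr H) (fun q : (κ × S) × ι => blk q.1.2) ν y'' C →
        ‖(Φ ∘ₗ (coordEquiv (S := κ × S) b).symm.toLinearMap ∘ₗ Dl) (GExt ν)‖ ≤
          B₃ * Bh * g.len y ^ (1 - γ) * cζ * Real.exp (-(δ₀ / 6 * g.dist y y'')) * C := fun y'' ν C hν => by
      simpa only [LinearMap.coe_comp, Function.comp_apply, LinearEquiv.coe_toLinearMap] using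
        hGLp Dl Φ y p₀ hp₀ γ Bh cζ hBh hcζ h343 y'' ν C hν
    have hdev := input345_of_inverse (R := Rr) (H := H) (fun q : (κ × S) × ι => blk q.1.2) d (Finset.univ : Finset (κ ⊕ κ))
      δ₀ (1 / 5 * δ₀) (1 / 100) (1 / 100) (9 / 50 * δ₀) Λ (cV385 (Fintype.card κ) α₁ C₀ (M₂ * (∑ i, ‖b i‖) * Real.exp (1 / 5 * δ₀ * d₀))) K (kappa383 κQb cFb abar Λ (B6.c1 d δ₀ (1 / 100)) α₁) α₁ B₀ δ₀ (1 / 100) (1 / 100) Λ (δ₀ / 6) (δ₀ / 7)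
      (B₃ * Bh * g.len y ^ (1 - γ) * cζ) (fun _ => (14 * ((Fintype.card κ : ℝ) + 1) * M₂ * (∑ i, ‖b i‖) * Real.exp (1 / 5 * δ₀ * d₀)))
      hB₀ hcV hK hκ₂ hα₁0 hΛ0 hρ0 (by norm_num) (by norm_num) hδ₀.le hr hcK0 hsum hΛ0 hA₃ hρ₃ hρ₃r hρ₃ρ hdnn htri hlen h261β h261β hT1 hT1i
      (V1 := fun k => conj b (V1Letter T U A k) + conj b (V1Letter₂ T U A k))
      (D := fun k => conj b (diffLetter (bT T) (bU U) ((g.eta : ℂ)⁻¹) k))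
      hV₃ hΔG hE hV0' (fun k _ => hV1 k) hP₁ hP₂ hGDs5 (Φ ∘ₗ (coordEquiv (S := κ × S) b).symm.toLinearMap ∘ₗ Dl) y hΨE y' μ M hμ N hN
      (fun k _ z => (h344 k z).trans (mul_le_mul_of_nonneg_left (exp_rate_mono h15 (hdnn _ _)) hN)) N₂ hN₂
      (by
        have h1 := h345.trans (mul_le_mul_of_nonneg_left (exp_rate_mono h15 (hdnn _ _)) hN₂)
        simpa only [LinearMap.coe_comp, Function.comp_apply, LinearEquiv.coe_toLinearMap, Module.End.mul_apply] using h1)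
    have hdev' : ‖Φ ((coordEquiv b).symm ((Dl * GExt * Ds) μ))‖ ≤
        (N₂ + B₃ * Bh * g.len y ^ (1 - γ) * cζ * Λ * B6.c1 d δ₀ (1 / 100) * (g.len y)⁻¹ *
          (α₁ * B6.c1 d δ₀ (1 / 100) * (((cV385 (Fintype.card κ) α₁ C₀ (M₂ * (∑ i, ‖b i‖) * Real.exp (1 / 5 * δ₀ * d₀))) + K + (kappa383 κQb cFb abar Λ (B6.c1 d δ₀ (1 / 100)) α₁)) * B₀ * Λ * M + (cV385 (Fintype.card κ) α₁ C₀ (M₂ * (∑ i, ‖b i‖) * Real.exp (1 / 5 * δ₀ * d₀))) * N))) *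
        Real.exp (-(δ₀ / 7 * g.dist y y')) := by
      simpa only [LinearMap.coe_comp, Function.comp_apply, LinearEquiv.coe_toLinearMap, Module.End.mul_apply] using hdev
    refine hdev'.trans ?_
    have hE₀ : 0 ≤ Real.exp (-(δ₀ / 7 * g.dist y y')) := Real.exp_nonneg _
    have hS : 0 ≤ Bh * g.len y ^ (1 - γ) * cζ * (g.len y)⁻¹ * (N + M) :=
      mul_nonneg (mul_nonneg (mul_nonneg (mul_nonneg hBh (Real.rpow_nonneg (hlen y).le _)) hcζ) (inv_nonneg.mpr (hlen y).le))
        (add_nonneg hN hM)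
    have hQq : α₁ * B6.c1 d δ₀ (1 / 100) * (((cV385 (Fintype.card κ) α₁ C₀ (M₂ * (∑ i, ‖b i‖) * Real.exp (1 / 5 * δ₀ * d₀))) + K + (kappa383 κQb cFb abar Λ (B6.c1 d δ₀ (1 / 100)) α₁)) * B₀ * Λ * M + (cV385 (Fintype.card κ) α₁ C₀ (M₂ * (∑ i, ‖b i‖) * Real.exp (1 / 5 * δ₀ * d₀))) * N) ≤ (α₁ * (B6.c1 d δ₀ (1 / 100)) * (((cV385 (Fintype.card κ) α₁ C₀ (M₂ * (∑ i, ‖b i‖) * Real.exp (1 / 5 * δ₀ * d₀))) + K + (kappa383 κQb cFb abar Λ (B6.c1 d δ₀ (1 / 100)) α₁)) * B₀ * Λ + (cV385 (Fintype.card κ) α₁ C₀ (M₂ * (∑ i, ‖b i‖) * Real.exp (1 / 5 * δ₀ * d₀))))) * (N + M) := by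
      have i1 : ((cV385 (Fintype.card κ) α₁ C₀ (M₂ * (∑ i, ‖b i‖) * Real.exp (1 / 5 * δ₀ * d₀))) + K + (kappa383 κQb cFb abar Λ (B6.c1 d δ₀ (1 / 100)) α₁)) * B₀ * Λ * M ≤ ((cV385 (Fintype.card κ) α₁ C₀ (M₂ * (∑ i, ‖b i‖) * Real.exp (1 / 5 * δ₀ * d₀))) + K + (kappa383 κQb cFb abar Λ (B6.c1 d δ₀ (1 / 100)) α₁)) * B₀ * Λ * (N + M) :=
        mul_le_mul_of_nonneg_left (le_add_of_nonneg_left hN) (by positivity)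
      have i2 : (cV385 (Fintype.card κ) α₁ C₀ (M₂ * (∑ i, ‖b i‖) * Real.exp (1 / 5 * δ₀ * d₀))) * N ≤ (cV385 (Fintype.card κ) α₁ C₀ (M₂ * (∑ i, ‖b i‖) * Real.exp (1 / 5 * δ₀ * d₀))) * (N + M) := mul_le_mul_of_nonneg_left (le_add_of_nonneg_right hM) hcV
      have i3 := add_le_add i1 i2
      have e : (α₁ * (B6.c1 d δ₀ (1 / 100)) * (((cV385 (Fintype.card κ) α₁ C₀ (M₂ * (∑ i, ‖b i‖) * Real.exp (1 / 5 * δ₀ * d₀))) + K + (kappa383 κQb cFb abar Λ (B6.c1 d δ₀ (1 / 100)) α₁)) * B₀ * Λ + (cV385 (Fintype.card κ) α₁ C₀ (M₂ * (∑ i, ‖b i‖) * Real.exp (1 / 5 * δ₀ * d₀))))) * (N + M) = α₁ * B6.c1 d δ₀ (1 / 100) * (((cV385 (Fintype.card κ) α₁ C₀ (M₂ * (∑ i, ‖b i‖) * Real.exp (1 / 5 * δ₀ * d₀))) + K + (kappa383 κQb cFb abar Λ (B6.c1 d δ₀ (1 / 100)) α₁)) * B₀ * Λ * (N + M) + (cV385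 (Fintype.card κ) α₁ C₀ (M₂ * (∑ i, ‖b i‖) * Real.exp (1 / 5 * δ₀ * d₀))) * (N + M)) := by ring
      rw [e]
      exact mul_le_mul_of_nonneg_left i3 (mul_nonneg hα₁0 hc₂)
    have h1 : B₃ * Bh * g.len y ^ (1 - γ) * cζ * Λ * B6.c1 d δ₀ (1 / 100) * (g.len y)⁻¹ *
          (α₁ * B6.c1 d δ₀ (1 / 100) * (((cV385 (Fintype.card κ) α₁ C₀ (M₂ * (∑ i, ‖b i‖) * Real.exp (1 / 5 * δ₀ * d₀))) + K + (kappa383 κQb cFb abar Λ (B6.c1 d δ₀ (1 / 100)) α₁)) * B₀ * Λ * M + (cV385 (Fintype.card κ) α₁ C₀ (M₂ * (∑ i, ‖b i‖) * Real.exp (1 / 5 * δ₀ * d₀))) * N))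
        ≤ (B₃ * Λ * (B6.c1 d δ₀ (1 / 100)) * (α₁ * (B6.c1 d δ₀ (1 / 100)) * (((cV385 (Fintype.card κ) α₁ C₀ (M₂ * (∑ i, ‖b i‖) * Real.exp (1 / 5 * δ₀ * d₀))) + K + (kappa383 κQb cFb abar Λ (B6.c1 d δ₀ (1 / 100)) α₁)) * B₀ * Λ + (cV385 (Fintype.card κ) α₁ C₀ (M₂ * (∑ i, ‖b i‖) * Real.exp (1 / 5 * δ₀ * d₀)))))) * (Bh * g.len y ^ (1 - γ) * cζ * (g.len y)⁻¹ * (N + M)) := by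
      have hpre : 0 ≤ B₃ * Bh * g.len y ^ (1 - γ) * cζ * Λ * B6.c1 d δ₀ (1 / 100) * (g.len y)⁻¹ :=
        mul_nonneg (mul_nonneg (mul_nonneg hA₃ hΛ0) hc₂) (inv_nonneg.mpr (hlen y).le)
      refine (mul_le_mul_of_nonneg_left hQq hpre).trans (le_of_eq ?_)
      ring
    have h2 : (B₃ * Λ * (B6.c1 d δ₀ (1 / 100)) * (α₁ * (B6.c1 d δ₀ (1 / 100)) * (((cV385 (Fintype.card κ) α₁ C₀ (M₂ * (∑ i, ‖b i‖) * Real.exp (1 / 5 * δ₀ * d₀))) + K + (kappa383 κQb cFb abar Λ (B6.c1 d δ₀ (1 / 100)) α₁)) * B₀ * Λ + (cV385 (Fintype.card κ) α₁ C₀ (M₂ * (∑ i, ‖b i‖) * Real.exp (1 / 5 * δ₀ * d₀)))))) * (Bh * g.len y ^ (1 - γ) * cζ * (g.len y)⁻¹ * (N + M)) ≤ KB₂ * (Bh * g.len y ^ (1 - γ) * cζ * (g.len y)⁻¹ * (N + M)) :=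
      mul_le_mul_of_nonneg_right (by linarith only [hK2, hcoefVI]) hS
    have h3 : N₂ ≤ KB₂ * N₂ := by
      have : 0 ≤ (KB₂ - 1) * N₂ := mul_nonneg (by linarith only [hK2, hcoefVI]) hN₂
      linarith
    have h4 : 0 ≤ KB₁ * (N₂ + Bh * g.len y ^ (1 - γ) * cζ * (g.len y)⁻¹ * (N + M)) := mul_nonneg hKB₁ (add_nonneg hN₂ hS)
    have h5 : N₂ + B₃ * Bh * g.len y ^ (1 - γ) * cζ * Λ * B6.c1 d δ₀ (1 / 100) * (g.len y)⁻¹ *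
          (α₁ * B6.c1 d δ₀ (1 / 100) * (((cV385 (Fintype.card κ) α₁ C₀ (M₂ * (∑ i, ‖b i‖) * Real.exp (1 / 5 * δ₀ * d₀))) + K + (kappa383 κQb cFb abar Λ (B6.c1 d δ₀ (1 / 100)) α₁)) * B₀ * Λ * M + (cV385 (Fintype.card κ) α₁ C₀ (M₂ * (∑ i, ‖b i‖) * Real.exp (1 / 5 * δ₀ * d₀))) * N))
        ≤ (KB₁ + KB₂) * (N₂ + Bh * g.len y ^ (1 - γ) * cζ * (g.len y)⁻¹ * (N + M)) := by nlinarith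
    exact mul_le_mul_of_nonneg_right h5 hE₀

end Final

end Literature.MathematicalPhysics.QuantumFieldTheory.Balaban1983to89.B9Thm34HolderInputG

end
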